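import Literature.MathematicalPhysics.QuantumFieldTheory.Balaban1983to89.B4TorusPairFam
import Literature.MathematicalPhysics.QuantumFieldTheory.Balaban1983to89.B4Thm19ShortestContour

/-!
# `Balaban1983to89.B4ThmTorusPairEta` — [Balaban1983RegularityDecay] THEOREM p. 573, (1.9)–(1.12), AND THE BOUND (1.8),
# ON THE FAMILY OF TORUS REGION PAIRS `Ω ⊂ Ω₀ ⊂ T_η` AT A (1.7)-REGULAR TORUS FIELD, IN THE TYPED `η`-UNIFORM FORM —
# by periodic lifting from the lattice theorem `B4ThmRegionPairEta.thmPrintedNN_regionPairFam`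

statement-level skeleton of published theorems with citation tags; proofs where landed; nothing here is a claim about the Yang–Mills mass gap

CITATION HEADER.  T. Bałaban, *Regularity and decay of lattice Green's functions*, Commun. Math. Phys. **89** (1983)
571–597, doi:10.1007/bf01214744 [Balaban1983RegularityDecay] (cell paper B4; held text
`paper:balaban1983-cmp89-regularity-decay`, journal page = PDF page + 570; p. 572 [PDF 2], p. 573 [PDF 3]).  Unit
`lit-balaban-r01` gen 9 (B4 fold owner; HOME `run/shared/lean/pub/lit-balaban/`), SKELETON rows **B4.Thm@573** /
**B4.Eq1.8** — the torus qualifier «Ω ⊂ T_η at a regular A ≠ 0 absent-as-proved» of ROWS-B4 v1.64 §D — file 4 of the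
r01 g9 programme (`B4TorusRegionOp` → `B4TorusRegionLift` → `B4TorusPairFam` → THIS FILE).

WHAT IS PRINTED.  p. 572 [PDF 2], verbatim: «Another common case is to consider operators on subsets of a torus T_η
which we identify with a rectangular parallelepiped in ηZ^d with periodic conditions. … We consider subsets Ω which are
unions of big blocks.»  p. 573 [PDF 3], verbatim: «Theorem (Proposition 2.1 of [1]). For α < 1 there exist positive
constants δ₀, c₀, R₀ independent of A, k, Ω and depending on d, M only, c₀ on α also, such that for e sufficiently small
and for an arbitrary function f : Ω → R^N, we have [(1.9)] for x, x′ ∈ Ω, and satisfying the condition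
dist({x, x′}, Ω^c) ≥ R₀. Similarly [(1.10)] for x ∈ Ω, dist(x, Ω^c) ≥ R₀. If Ω ⊂ Ω₀, then for δG_k(Ω, Ω₀, A) defined by
the equality δG_k(Ω, Ω₀, A) = G_k(Ω, A) − G_k(Ω₀, A), (1.11) we have the inequalities (1.5) and (1.6) (with the same
restrictions on x, x′) with the additional factor [(1.12)] on the right hand sides. For some simple sets Ω, e.g. for
rectangular parallelepipeds, the inequalities hold without any restrictions on the points x, x′, i.e. for all
x, x′ ∈ Ω.»; and «there exists a positive constant γ₀ such that for e sufficiently small and for a regular vector field A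
−Δ^{η,N}_{A,Ω} + aP_k(A) ≥ γ₀I. (1.8) The constant γ₀ is independent of the lattice spacing η, as well as of Ω and of A.»

WHAT THIS MODULE PROVES.  §1 tools (tails, decay monotonicity, the lattice functionals bounded from below, the Hölder
quotient bounds each admissible term); §2 the lift data of an instance (copy-`0` lifts, the lattice operators of the
lifted instances, `u∘π = G̃ H̃(u∘π)`, the near part of `H̃(u∘π)` is the near part of `f∘π`, extension by zero commutes
with the lift, lattice distances dominate torus distances); §3 THE SIX MEMBERS ON THE TORUS FAMILY by lifting — value
and derivative of (1.10), of (1.11)–(1.12), and the two Hölder members (close pairs by lifted contours, far pairs by the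
derivative members); §4 **`thmPrintedNN_torusPairFam : ThmPrintedNN (torusPairFam F d ℓ a₋ a₊ m²₊ c β K)`** with the
lattice family's `δ₀, R₀, e₁` and `4(d+1)c₀`, **`claim18Printed_torusPairFam`** ((1.8), by the form comparison
`regionOp_form_le_torusOp_form` and `claim18Printed_regionPairFam` on the one-copy instance), `hypotheses_met`.
THE METHOD (OURS, disclosed; the print treats the torus case as read): a field on a torus region composed with the
reduction of representatives is a field on the periodic lift `Ω̃_R ⊂ ηℤ^{d+1}`; there the lattice operator (1.6) at the
periodic field reproduces the torus operator at interior sites (`B4TorusRegionLift`), so `u∘π = G̃(f∘π·1_near + g)`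
with `g` supported `≥ S` periods away and `‖g‖_∞ ≤ (4(d+1)n² + m² + a)‖u‖_∞ + ‖f‖_∞`; the lattice Theorem bounds the
near piece by the printed right-hand side (torus distances are never larger than lattice distances of lifts, and are
equal on short vectors) and the far piece by `c₀e^{−δ₀S}·const`, and `S → ∞`.
HONEST SCOPE.  As `B4ThmRegionPairEta` (abelian one-parameter flow (1.2), component field, staircase contours, running
coefficient `a_k`, windows `[a₋,a₊] × [0,m²₊]`, Euclidean site norms, `0 ≤ α < 1`) on the torus family of
`B4TorusPairFam` (`ℓ^∞` torus metric, fine period `≥ 3`, `K ∣ P_ν`, `rect` = whole torus); the torus Hölder constant is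
`4(d+1)` times the lattice one.  No `sorry`, no new `Prop` fact; axioms standard.
-/

namespace Literature.MathematicalPhysics.QuantumFieldTheory.Balaban1983to89.B4ThmTorusPairEta

open Literature.MathematicalPhysics.QuantumFieldTheory.Balaban1983to89.B4 (EtaSetting Ineq19_110 Ineq111_112 Claim18Printed)
open Literature.MathematicalPhysics.QuantumFieldTheory.Balaban1983to89.B4Ineq111ZeroNestEta (ThmPrintedNN)
open Literature.MathematicalPhysics.QuantumFieldTheory.Balaban1983to89.B4TorusPositivity (wrap box mem_box wrap_mem_box
  wrap_eq_self_of_mem wrap_wrap_add)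
open Literature.MathematicalPhysics.QuantumFieldTheory.Balaban1983to89.B4Reflection242 (boxDom mem_boxDom nbrs mem_nbrs
  blk blk_mem_boxDom blk_mul supNorm_add_le supNorm_le_of_forall)
open Literature.MathematicalPhysics.QuantumFieldTheory.Balaban1983to89.B4GaugeCovariance
open Literature.MathematicalPhysics.QuantumFieldTheory.Balaban1983to89.B4ContourShift (supNorm supNorm_nonneg
  exists_supNorm_eq abs_le_supNorm)
open Literature.MathematicalPhysics.QuantumFieldTheory.Balaban1983to89.B4TorusKernel (supNorm_neg)
open Literature.MathematicalPhysics.QuantumFieldTheory.Balaban1983to89.B4Lower18 (fineDom mem_fineDom IsBlockUnion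
  fineDom_isBlockUnion supNorm_sub_le_one_of_mem_nbrs)
open Literature.MathematicalPhysics.QuantumFieldTheory.Balaban1983to89.B4Lower18Regular (e1 PathRel lsum
  transport_fieldLink dotProduct_self_nonneg')
open Literature.MathematicalPhysics.QuantumFieldTheory.Balaban1983to89.B4Lower18RegularRegion (compField)
open Literature.MathematicalPhysics.QuantumFieldTheory.Balaban1983to89.B4Lemma21Region (regionOp regionDeriv siteNorm)
open Literature.MathematicalPhysics.QuantumFieldTheory.Balaban1983to89.B4Lemma22Reduce231 (supN le_supN supN_nonneg
  supN_le siteNorm_nonneg siteNorm_zero siteNorm_add_le supN_zero fld_zero)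
open Literature.MathematicalPhysics.QuantumFieldTheory.Balaban1983to89.B4Lemma22ReduceDeriv (siteNorm_flow)
open Literature.MathematicalPhysics.QuantumFieldTheory.Balaban1983to89.B4Lemma22HolderBox (IsNNChain siteNorm_sub_le)
open Literature.MathematicalPhysics.QuantumFieldTheory.Balaban1983to89.B4Thm19ShortestContour (le_holderQ)
open Literature.MathematicalPhysics.QuantumFieldTheory.Balaban1983to89.B4RegionCubeCarrier (incl inReg fineDom_mono)
open Literature.MathematicalPhysics.QuantumFieldTheory.Balaban1983to89.B4Eq221L2FactorRegion (acBond)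
open Literature.MathematicalPhysics.QuantumFieldTheory.Balaban1983to89.B4Eq16GreenExists (b4Green_region_mulVec_b4Op)
open Literature.MathematicalPhysics.QuantumFieldTheory.Balaban1983to89.B4ThmRegionPairEta (RegionPairInst regionPairFam
  thmPrintedNN_regionPairFam claim18Printed_regionPairFam Kmod region_pair_members)
open Literature.MathematicalPhysics.QuantumFieldTheory.Balaban1983to89.B4TorusRegionOp
open Literature.MathematicalPhysics.QuantumFieldTheory.Balaban1983to89.B4TorusRegionLift
open Literature.MathematicalPhysics.QuantumFieldTheory.Balaban1983to89.B4TorusPairFam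
open scoped Matrix

noncomputable section

variable {d : ℕ} {ι : Type} [Fintype ι] [DecidableEq ι]

/-! ## §1. Tools -/

omit [Fintype ι] [DecidableEq ι] in
/-- **VANISHING TAILS**: `a ≤ b + c·e^{−δS}` for all large `S ∈ ℕ` forces `a ≤ b`. [cite: Balaban1983RegularityDecay, (1.10) p.573 «exp(−δ₀ dist)», dictionary] -/
theorem le_of_forall_exp_tail {a b c δ : ℝ} (hδ : 0 < δ) (S₀ : ℝ)
    (h : ∀ S : ℕ, S₀ ≤ S → a ≤ b + c * Real.exp (-(δ * S))) : a ≤ b := by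
  refine le_of_forall_pos_le_add fun ε hε => ?_
  rcases le_or_gt c 0 with hc | hc
  · obtain ⟨S, hS⟩ := exists_nat_ge S₀
    have h1 := h S hS
    have h2 : c * Real.exp (-(δ * S)) ≤ 0 := mul_nonpos_of_nonpos_of_nonneg hc (Real.exp_pos _).le
    linarith
  · obtain ⟨S, hS⟩ := exists_nat_ge (max S₀ (c / (ε * δ)))
    have hS₀ : S₀ ≤ S := (le_max_left _ _).trans hS
    have hS₁ : c / (ε * δ) ≤ S := (le_max_right _ _).trans hS
    have h1 := h S hS₀
    have h3 : c ≤ ε * (δ * S) := by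
      rw [div_le_iff₀ (by positivity)] at hS₁; linarith
    have h4 : δ * S + 1 ≤ Real.exp (δ * S) := Real.add_one_le_exp _
    have h5 : c * Real.exp (-(δ * S)) ≤ ε := by
      rw [Real.exp_neg, ← div_eq_mul_inv, div_le_iff₀ (Real.exp_pos _)]
      nlinarith [hε.le]
    linarith

omit [Fintype ι] [DecidableEq ι] in
/-- decay bounds are monotone in the distance and the norm. [cite: Balaban1983RegularityDecay, (1.10) p.573, dictionary] -/
theorem decay_mono {c δ D D' s s' : ℝ} (hc : 0 ≤ c) (hδ : 0 ≤ δ) (hD : D' ≤ D) (hs : s ≤ s') (hs0 : 0 ≤ s) :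
    c * Real.exp (-(δ * D)) * s ≤ c * Real.exp (-(δ * D')) * s' := by
  have h1 : Real.exp (-(δ * D)) ≤ Real.exp (-(δ * D')) := Real.exp_le_exp.2 (by nlinarith)
  exact mul_le_mul (mul_le_mul_of_nonneg_left h1 hc) hs hs0 (by positivity)

omit [Fintype ι] [DecidableEq ι] in
/-- decay bounds with the factor (1.12) are monotone in the three distances and the norm. [cite: Balaban1983RegularityDecay, (1.12) p.573, dictionary] -/
theorem decay_mono₂ {c δ D D' B B' E E' s s' : ℝ} (hc : 0 ≤ c) (hδ : 0 ≤ δ) (hD : D' ≤ D) (hB : B' ≤ B) (hE : E' ≤ E)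
    (hs : s ≤ s') (hs0 : 0 ≤ s) :
    c * Real.exp (-(δ * D)) * Real.exp (-(δ * B + δ * E)) * s
      ≤ c * Real.exp (-(δ * D')) * Real.exp (-(δ * B' + δ * E')) * s' := by
  have h1 : Real.exp (-(δ * D)) ≤ Real.exp (-(δ * D')) := Real.exp_le_exp.2 (by nlinarith)
  have h2 : Real.exp (-(δ * B + δ * E)) ≤ Real.exp (-(δ * B' + δ * E')) := Real.exp_le_exp.2 (by nlinarith)
  exact mul_le_mul (mul_le_mul (mul_le_mul_of_nonneg_left h1 hc) h2 (Real.exp_pos _).le (by positivity)) hs hs0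
    (by positivity)

/-- a transported difference is at most the sum of the site norms (orthogonal transporter of the abelian flow).
[cite: Balaban1983RegularityDecay, (1.4) p.572 «U(A(Γ))», dictionary] -/
theorem siteNorm_transport_sub_le (F : OrthFlow ι) {X : Type} (κ : ℝ) (B : X → X → ℝ) (x : X) (l : List X)
    (a b : ι → ℝ) : siteNorm (transport (fieldLink F κ B) x l *ᵥ a - b) ≤ siteNorm a + siteNorm b := by
  rw [transport_fieldLink]
  exact (siteNorm_sub_le _ _).trans (by rw [siteNorm_flow])

section LatticeTools

variable {ℓ : ℕ} {amin aplus m2plus : ℝ} (j : RegionPairInst d ℓ amin aplus m2plus)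

omit [DecidableEq ι] in
/-- membership in the support. [cite: Balaban1983RegularityDecay, (1.9) p.573 «supp f», dictionary] -/
theorem lat_mem_supp {g : ↥(fineDom ((ℓ + 1) ^ j.k) j.Ωc) × ι → ℝ} {z : ↥(fineDom ((ℓ + 1) ^ j.k) j.Ωc)} :
    z ∈ j.supp g ↔ ∃ jj, g (z, jj) ≠ 0 := by
  classical
  unfold RegionPairInst.supp
  simp

omit [DecidableEq ι] in
/-- a source with empty support vanishes. [cite: Balaban1983RegularityDecay, (1.9) p.573 «supp f», dictionary] -/
theorem lat_eq_zero_of_supp {g : ↥(fineDom ((ℓ + 1) ^ j.k) j.Ωc) × ι → ℝ} (h : ¬ (j.supp g).Nonempty) : g = 0 := by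
  funext p
  exact j.eq_zero_of_not_mem_supp g p fun hp => h ⟨p.1, hp⟩

omit [DecidableEq ι] in
/-- a uniform lower bound on the distances to the support bounds `dist(x, supp g)` from below.
[cite: Balaban1983RegularityDecay, (1.10) p.573 «dist(x, supp f)», dictionary] -/
theorem lat_le_sdist1 (x : ↥(fineDom ((ℓ + 1) ^ j.k) j.Ωc)) (g : ↥(fineDom ((ℓ + 1) ^ j.k) j.Ωc) × ι → ℝ) {D : ℝ}
    (hne : (j.supp g).Nonempty)
    (h : ∀ z ∈ j.supp g, D * (((ℓ + 1) ^ j.k : ℕ) : ℝ) ≤ supNorm (x.1 - z.1)) : D ≤ j.sdist1 x g := by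
  have hnr : (0 : ℝ) < (((ℓ + 1) ^ j.k : ℕ) : ℝ) := by exact_mod_cast Nat.one_le_pow j.k (ℓ + 1) (Nat.succ_pos ℓ)
  unfold RegionPairInst.sdist1
  rw [dif_pos hne]
  exact Finset.le_inf' _ _ fun z hz => by rw [le_div_iff₀ hnr]; exact h z hz

omit [DecidableEq ι] in
/-- a uniform lower bound on `dist(z, Ω^c)`, `z ∈ supp g`, bounds `dist(supp g, Ω^c)` from below.
[cite: Balaban1983RegularityDecay, (1.12) p.573 «dist(supp f, Ω^c)», dictionary] -/
theorem lat_le_bdistS (g : ↥(fineDom ((ℓ + 1) ^ j.k) j.Ωc) × ι → ℝ) {E : ℝ} (hne : (j.supp g).Nonempty)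
    (h : ∀ z ∈ j.supp g, E ≤ j.cdist z) : E ≤ j.bdistS g := by
  unfold RegionPairInst.bdistS
  rw [dif_pos hne]
  exact Finset.le_inf' _ _ h

omit [DecidableEq ι] in
/-- a uniform lower bound on the distances to the points outside `Ω` bounds `dist(x, Ω^c)` from below.
[cite: Balaban1983RegularityDecay, Theorem p.573 «dist(x, Ω^c) ≥ R₀», dictionary] -/
theorem lat_le_cdist (x : ↥(fineDom ((ℓ + 1) ^ j.k) j.Ωc)) {D : ℝ}
    (hne : ∃ z : Fin (d + 1) → ℤ, z ∉ fineDom ((ℓ + 1) ^ j.k) j.Ωc)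
    (h : ∀ z : Fin (d + 1) → ℤ, z ∉ fineDom ((ℓ + 1) ^ j.k) j.Ωc →
      D * (((ℓ + 1) ^ j.k : ℕ) : ℝ) ≤ supNorm (x.1 - z)) : D ≤ j.cdist x := by
  have hnr : (0 : ℝ) < (((ℓ + 1) ^ j.k : ℕ) : ℝ) := by exact_mod_cast Nat.one_le_pow j.k (ℓ + 1) (Nat.succ_pos ℓ)
  obtain ⟨z₀, hz₀⟩ := hne
  haveI : Nonempty {z : Fin (d + 1) → ℤ // z ∉ fineDom ((ℓ + 1) ^ j.k) j.Ωc} := ⟨⟨z₀, hz₀⟩⟩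
  unfold RegionPairInst.cdist
  exact le_ciInf fun z => by rw [le_div_iff₀ hnr]; exact h z.1 z.2

omit [DecidableEq ι] in
/-- **THE DECAY TRANSFER**: a value bounded by the lattice decay factor of a source `g` is bounded by the decay factor at
any distance `D` that separates the point from the support of `g`, with any larger norm (the empty support gives `0`).
[cite: Balaban1983RegularityDecay, (1.10) p.573, dictionary] -/
theorem lat_decay_transfer (x : ↥(fineDom ((ℓ + 1) ^ j.k) j.Ωc)) (g : ↥(fineDom ((ℓ + 1) ^ j.k) j.Ωc) × ι → ℝ)
    {v : ι → ℝ} {c δ D s : ℝ} (hc : 0 ≤ c) (hδ : 0 ≤ δ) (hs : supN g ≤ s)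
    (hv : siteNorm v ≤ c * Real.exp (-(δ * j.sdist1 x g)) * supN g) (hv0 : (∀ p, g p = 0) → v = 0)
    (hD : ∀ z ∈ j.supp g, D * (((ℓ + 1) ^ j.k : ℕ) : ℝ) ≤ supNorm (x.1 - z.1)) :
    siteNorm v ≤ c * Real.exp (-(δ * D)) * s := by
  by_cases hne : (j.supp g).Nonempty
  · exact hv.trans (decay_mono hc hδ (lat_le_sdist1 j x g hne hD) hs (supN_nonneg g))
  · rw [hv0 (fun p => congrFun (lat_eq_zero_of_supp j hne) p), siteNorm_zero]
    have : 0 ≤ s := (supN_nonneg g).trans hs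
    positivity

omit [DecidableEq ι] in
/-- the decay transfer with the factor (1.12). [cite: Balaban1983RegularityDecay, (1.12) p.573, dictionary] -/
theorem lat_decay_transfer₂ (x : ↥(fineDom ((ℓ + 1) ^ j.k) j.Ωc)) (g : ↥(fineDom ((ℓ + 1) ^ j.k) j.Ωc) × ι → ℝ)
    {v : ι → ℝ} {c δ D B E s : ℝ} (hc : 0 ≤ c) (hδ : 0 ≤ δ) (hs : supN g ≤ s)
    (hv : siteNorm v ≤ c * Real.exp (-(δ * j.sdist1 x g)) * Real.exp (-(δ * j.cdist x + δ * j.bdistS g)) * supN g)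
    (hv0 : (∀ p, g p = 0) → v = 0)
    (hD : ∀ z ∈ j.supp g, D * (((ℓ + 1) ^ j.k : ℕ) : ℝ) ≤ supNorm (x.1 - z.1)) (hB : B ≤ j.cdist x)
    (hE : ∀ z ∈ j.supp g, E ≤ j.cdist z) :
    siteNorm v ≤ c * Real.exp (-(δ * D)) * Real.exp (-(δ * B + δ * E)) * s := by
  by_cases hne : (j.supp g).Nonempty
  · exact hv.trans (decay_mono₂ hc hδ (lat_le_sdist1 j x g hne hD) hB (lat_le_bdistS j g hne hE) hs (supN_nonneg g))
  · rw [hv0 (fun p => congrFun (lat_eq_zero_of_supp j hne) p), siteNorm_zero]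
    have : 0 ≤ s := (supN_nonneg g).trans hs
    positivity

omit [Fintype ι] [DecidableEq ι] in
/-- extension by zero of the zero source. [cite: Balaban1983RegularityDecay, (1.11) p.573, dictionary] -/
theorem lat_extR_zero : j.extR (0 : ↥(fineDom ((ℓ + 1) ^ j.k) j.Ωc) × ι → ℝ) = 0 := by
  funext p
  unfold RegionPairInst.extR
  split_ifs <;> rfl

/-- `(G_k(Ω,A)H)Φ = Φ` on a lattice region (`a > 0`, `m² ≥ 0`). [cite: Balaban1983RegularityDecay, (1.6) p.572] -/
theorem inv_regionOp_mulVec_regionOp (F : OrthFlow ι) (e : ℝ) {n : ℕ} (hn : 1 ≤ n) {a : ℝ} (ha : 0 < a) {m2 : ℝ}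
    (hm : 0 ≤ m2) (Ωc : Finset (Fin (d + 1) → ℤ)) (Ac : (Fin (d + 1) → ℤ) → Fin (d + 1) → ℝ)
    (Φ : ↥(fineDom n Ωc) × ι → ℝ) :
    (regionOp F e hn a m2 Ωc Ac)⁻¹ *ᵥ (regionOp F e hn a m2 Ωc Ac *ᵥ Φ) = Φ :=
  b4Green_region_mulVec_b4Op F (e / n) hn ha hm Ωc (fun u v => compField Ac u.1 v.1) Φ

end LatticeTools

/-! ## §2. The lift data of a torus instance -/

namespace LiftData

open TorusPairInst

variable {ℓ : ℕ} {amin aplus m2plus : ℝ} (i : TorusPairInst d ℓ amin aplus m2plus) (F : OrthFlow ι)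

/-- `a_k > 0`. [cite: Balaban1983RegularityDecay, (1.6) p.572 «a is a positive constant», dictionary] -/
theorem aK_pos (ha : 0 < amin) (hℓ : 1 ≤ ℓ) : 0 < i.aK := by
  have h1 : (1 : ℝ) ≤ ℓ := by exact_mod_cast hℓ
  exact B1.aSeq_pos (ha.trans_le i.ha1) (by linarith) i.hk

/-- `a_k ≥ 0` (for `a > 0`). [cite: Balaban1983RegularityDecay, (1.6) p.572, dictionary] -/
theorem aK_nonneg (ha : 0 < amin) (hℓ : 1 ≤ ℓ) : 0 ≤ i.aK := (aK_pos i ha hℓ).le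

/-- `n > 0` as a real number. [cite: Balaban1983RegularityDecay, p.572 «η = L^{−k}», dictionary] -/
theorem n_pos : (0 : ℝ) < (((ℓ + 1) ^ i.k : ℕ) : ℝ) := by exact_mod_cast (Nat.one_le_pow i.k (ℓ + 1) (Nat.succ_pos ℓ))

/-- THE COPY-`0` LIFT of a site of `Ω`. [cite: Balaban1983RegularityDecay, p.572 «periodic conditions», dictionary] -/
def base (R : ℕ) (x : ↥(fineDom ((ℓ + 1) ^ i.k) i.ΩT)) : ↥(fineDom ((ℓ + 1) ^ i.k) (liftLabels i.P R i.ΩT)) :=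
  ⟨x.1, mem_lift_of_mem (Nat.one_le_pow i.k (ℓ + 1) (Nat.succ_pos ℓ)) i.hP i.hboxΩ R x.2⟩

/-- THE COPY-`0` LIFT of a site of `Ω₀`. [cite: Balaban1983RegularityDecay, p.572 «periodic conditions», dictionary] -/
def base₀ (R : ℕ) (y : ↥(fineDom ((ℓ + 1) ^ i.k) i.Ω₀T)) : ↥(fineDom ((ℓ + 1) ^ i.k) (liftLabels i.P R i.Ω₀T)) :=
  ⟨y.1, mem_lift_of_mem (Nat.one_le_pow i.k (ℓ + 1) (Nat.succ_pos ℓ)) i.hP i.hbox R y.2⟩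

omit [Fintype ι] [DecidableEq ι] in
/-- the copy-`0` lift projects back. [cite: Balaban1983RegularityDecay, p.572, dictionary] -/
theorem proj_base (R : ℕ) (x : ↥(fineDom ((ℓ + 1) ^ i.k) i.ΩT)) :
    proj (Nat.one_le_pow i.k (ℓ + 1) (Nat.succ_pos ℓ)) i.hP i.hboxΩ R (base i R x) = x :=
  Subtype.ext (twrap_eq_self (val_mem_perBox (Nat.one_le_pow i.k (ℓ + 1) (Nat.succ_pos ℓ)) i.hboxΩ x))

omit [Fintype ι] [DecidableEq ι] in
/-- the copy-`0` lift of `Ω₀` projects back. [cite: Balaban1983RegularityDecay, p.572, dictionary] -/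
theorem proj_base₀ (R : ℕ) (y : ↥(fineDom ((ℓ + 1) ^ i.k) i.Ω₀T)) :
    proj (Nat.one_le_pow i.k (ℓ + 1) (Nat.succ_pos ℓ)) i.hP i.hbox R (base₀ i R y) = y :=
  Subtype.ext (twrap_eq_self (val_mem_perBox (Nat.one_le_pow i.k (ℓ + 1) (Nat.succ_pos ℓ)) i.hbox y))

omit [Fintype ι] [DecidableEq ι] in
/-- the copy-`0` lift is in copy `0`. [cite: Balaban1983RegularityDecay, p.572, dictionary] -/
theorem near_base (R : ℕ) (x : ↥(fineDom ((ℓ + 1) ^ i.k) i.ΩT)) : Near ((ℓ + 1) ^ i.k) i.P 0 (base i R x).1 :=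
  near_zero_of_blk_mem (i.hboxΩ ((mem_fineDom (Nat.one_le_pow i.k (ℓ + 1) (Nat.succ_pos ℓ))).1 x.2))

omit [Fintype ι] [DecidableEq ι] in
/-- the copy-`0` lift of `Ω₀` is in copy `0`. [cite: Balaban1983RegularityDecay, p.572, dictionary] -/
theorem near_base₀ (R : ℕ) (y : ↥(fineDom ((ℓ + 1) ^ i.k) i.Ω₀T)) : Near ((ℓ + 1) ^ i.k) i.P 0 (base₀ i R y).1 :=
  near_zero_of_blk_mem (i.hbox ((mem_fineDom (Nat.one_le_pow i.k (ℓ + 1) (Nat.succ_pos ℓ))).1 y.2))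

omit [Fintype ι] [DecidableEq ι] in
/-- the inclusion of the copy-`0` lift is the copy-`0` lift of the inclusion. [cite: Balaban1983RegularityDecay, p.572, dictionary] -/
theorem incl_base (R : ℕ) (x : ↥(fineDom ((ℓ + 1) ^ i.k) i.ΩT)) :
    incl (Nat.one_le_pow i.k (ℓ + 1) (Nat.succ_pos ℓ)) (i.liftInst R).hsub (base i R x)
      = base₀ i R (incl (Nat.one_le_pow i.k (ℓ + 1) (Nat.succ_pos ℓ)) i.hsub x) := rfl

omit [Fintype ι] [DecidableEq ι] in
/-- projections commute with the inclusions `Ω̃ ⊂ Ω̃₀`, `Ω ⊂ Ω₀`. [cite: Balaban1983RegularityDecay, p.572, dictionary] -/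
theorem proj_incl (R : ℕ) (xL : ↥(fineDom ((ℓ + 1) ^ i.k) (liftLabels i.P R i.ΩT))) :
    proj (Nat.one_le_pow i.k (ℓ + 1) (Nat.succ_pos ℓ)) i.hP i.hbox R (incl (Nat.one_le_pow i.k (ℓ + 1) (Nat.succ_pos ℓ)) (i.liftInst R).hsub xL)
      = incl (Nat.one_le_pow i.k (ℓ + 1) (Nat.succ_pos ℓ)) i.hsub (proj (Nat.one_le_pow i.k (ℓ + 1) (Nat.succ_pos ℓ)) i.hP i.hboxΩ R xL) := rfl

/-- `H̃ = −Δ + m² + a_kP_k(A^per)` on the lift `Ω̃_R`. [cite: Balaban1983RegularityDecay, (1.6) p.572] -/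
abbrev HL (R : ℕ) : Matrix (↥(fineDom ((ℓ + 1) ^ i.k) (liftLabels i.P R i.ΩT)) × ι)
    (↥(fineDom ((ℓ + 1) ^ i.k) (liftLabels i.P R i.ΩT)) × ι) ℝ :=
  regionOp F i.e (Nat.one_le_pow i.k (ℓ + 1) (Nat.succ_pos ℓ)) i.aK i.m2 (liftLabels i.P R i.ΩT) (perField ((ℓ + 1) ^ i.k) i.P i.Ac)

/-- `H̃₀` on the lift `Ω̃₀,R`. [cite: Balaban1983RegularityDecay, (1.6) p.572] -/
abbrev H₀L (R : ℕ) : Matrix (↥(fineDom ((ℓ + 1) ^ i.k) (liftLabels i.P R i.Ω₀T)) × ι)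
    (↥(fineDom ((ℓ + 1) ^ i.k) (liftLabels i.P R i.Ω₀T)) × ι) ℝ :=
  regionOp F i.e (Nat.one_le_pow i.k (ℓ + 1) (Nat.succ_pos ℓ)) i.aK i.m2 (liftLabels i.P R i.Ω₀T) (perField ((ℓ + 1) ^ i.k) i.P i.Ac)

/-- `D̃_μ` on the lift `Ω̃_R`. [cite: Balaban1983RegularityDecay, (1.3) p.572] -/
abbrev DL (R : ℕ) (μ : Fin (d + 1)) : Matrix (↥(fineDom ((ℓ + 1) ^ i.k) (liftLabels i.P R i.ΩT)) × ι)
    (↥(fineDom ((ℓ + 1) ^ i.k) (liftLabels i.P R i.ΩT)) × ι) ℝ :=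
  regionDeriv F i.e ((ℓ + 1) ^ i.k) (liftLabels i.P R i.ΩT) (perField ((ℓ + 1) ^ i.k) i.P i.Ac) μ

/-- `D̃_μ` on the lift `Ω̃₀,R`. [cite: Balaban1983RegularityDecay, (1.3) p.572] -/
abbrev D₀L (R : ℕ) (μ : Fin (d + 1)) : Matrix (↥(fineDom ((ℓ + 1) ^ i.k) (liftLabels i.P R i.Ω₀T)) × ι)
    (↥(fineDom ((ℓ + 1) ^ i.k) (liftLabels i.P R i.Ω₀T)) × ι) ℝ :=
  regionDeriv F i.e ((ℓ + 1) ^ i.k) (liftLabels i.P R i.Ω₀T) (perField ((ℓ + 1) ^ i.k) i.P i.Ac) μ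

/-- the lifted instance's Green's function is `H̃⁻¹`. [cite: Balaban1983RegularityDecay, (1.6) p.572, dictionary] -/
theorem GΩ_liftInst (R : ℕ) : (i.liftInst R).GΩ F = (HL i F R)⁻¹ := rfl

/-- the lifted instance's `G₀` is `H̃₀⁻¹`. [cite: Balaban1983RegularityDecay, (1.6) p.572, dictionary] -/
theorem G₀_liftInst (R : ℕ) : (i.liftInst R).G₀ F = (H₀L i F R)⁻¹ := rfl

/-- the lifted instance's derivative. [cite: Balaban1983RegularityDecay, (1.3) p.572, dictionary] -/
theorem DΩ_liftInst (R : ℕ) (μ : Fin (d + 1)) : (i.liftInst R).DΩ F μ = DL i F R μ := rfl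

/-- the lifted instance's derivative on `Ω̃₀`. [cite: Balaban1983RegularityDecay, (1.3) p.572, dictionary] -/
theorem D₀_liftInst (R : ℕ) (μ : Fin (d + 1)) : (i.liftInst R).D₀ F μ = D₀L i F R μ := rfl

/-- the instance `Ω̃₀ ⊂ Ω̃₀`'s Green's function is `H̃₀⁻¹`. [cite: Balaban1983RegularityDecay, (1.6) p.572, dictionary] -/
theorem GΩ_liftInst₀ (R : ℕ) : (i.liftInst₀ R).GΩ F = (H₀L i F R)⁻¹ := rfl

/-- the instance `Ω̃₀ ⊂ Ω̃₀`'s derivative. [cite: Balaban1983RegularityDecay, (1.3) p.572, dictionary] -/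
theorem DΩ_liftInst₀ (R : ℕ) (μ : Fin (d + 1)) : (i.liftInst₀ R).DΩ F μ = D₀L i F R μ := rfl

/-- `HG = 1` on the torus region (`a > 0`). [cite: Balaban1983RegularityDecay, (1.6) p.572] -/
theorem HT_mulVec_GT (ha : 0 < amin) (hℓ : 1 ≤ ℓ) (f : ↥(fineDom ((ℓ + 1) ^ i.k) i.ΩT) × ι → ℝ) :
    i.HT F *ᵥ (i.GT F *ᵥ f) = f :=
  torusOp_mulVec_inv_mulVec F (Nat.one_le_pow i.k (ℓ + 1) (Nat.succ_pos ℓ)) i.hboxΩ i.e (aK_pos i ha hℓ) i.hm1 i.Ac f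

/-- `H₀G₀ = 1` on the torus region `Ω₀`. [cite: Balaban1983RegularityDecay, (1.6) p.572] -/
theorem H₀T_mulVec_G₀T (ha : 0 < amin) (hℓ : 1 ≤ ℓ) (g : ↥(fineDom ((ℓ + 1) ^ i.k) i.Ω₀T) × ι → ℝ) :
    i.H₀T F *ᵥ (i.G₀T F *ᵥ g) = g :=
  torusOp_mulVec_inv_mulVec F (Nat.one_le_pow i.k (ℓ + 1) (Nat.succ_pos ℓ)) i.hbox i.e (aK_pos i ha hℓ) i.hm1 i.Ac g

/-- **`u∘π = G̃ H̃(u∘π)`** on the lift. [cite: Balaban1983RegularityDecay, (1.6) p.572 «periodic conditions»] -/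
theorem pull_eq (ha : 0 < amin) (hℓ : 1 ≤ ℓ) (R : ℕ) (u : ↥(fineDom ((ℓ + 1) ^ i.k) i.ΩT) × ι → ℝ) :
    pull (Nat.one_le_pow i.k (ℓ + 1) (Nat.succ_pos ℓ)) i.hP i.hboxΩ R u = (HL i F R)⁻¹ *ᵥ (HL i F R *ᵥ pull (Nat.one_le_pow i.k (ℓ + 1) (Nat.succ_pos ℓ)) i.hP i.hboxΩ R u) :=
  (inv_regionOp_mulVec_regionOp F i.e (Nat.one_le_pow i.k (ℓ + 1) (Nat.succ_pos ℓ)) (aK_pos i ha hℓ) i.hm1 _ _ _).symm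

/-- `u₀∘π = G̃₀ H̃₀(u₀∘π)` on the lift of `Ω₀`. [cite: Balaban1983RegularityDecay, (1.6) p.572 «periodic conditions»] -/
theorem pull₀_eq (ha : 0 < amin) (hℓ : 1 ≤ ℓ) (R : ℕ) (u₀ : ↥(fineDom ((ℓ + 1) ^ i.k) i.Ω₀T) × ι → ℝ) :
    pull (Nat.one_le_pow i.k (ℓ + 1) (Nat.succ_pos ℓ)) i.hP i.hbox R u₀ = (H₀L i F R)⁻¹ *ᵥ (H₀L i F R *ᵥ pull (Nat.one_le_pow i.k (ℓ + 1) (Nat.succ_pos ℓ)) i.hP i.hbox R u₀) :=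
  (inv_regionOp_mulVec_regionOp F i.e (Nat.one_le_pow i.k (ℓ + 1) (Nat.succ_pos ℓ)) (aK_pos i ha hℓ) i.hm1 _ _ _).symm

/-- **THE NEAR PART OF `H̃(G f ∘ π)` IS THE NEAR PART OF `f∘π`** (`S + 1 ≤ R`). [cite: Balaban1983RegularityDecay, (1.6) p.572 «periodic conditions»] -/
theorem cutNear_HL_pull (ha : 0 < amin) (hℓ : 1 ≤ ℓ) {S R : ℕ} (hSR : S + 1 ≤ R)
    (f : ↥(fineDom ((ℓ + 1) ^ i.k) i.ΩT) × ι → ℝ) :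
    cutNear ((ℓ + 1) ^ i.k) i.P S (HL i F R *ᵥ pull (Nat.one_le_pow i.k (ℓ + 1) (Nat.succ_pos ℓ)) i.hP i.hboxΩ R (i.GT F *ᵥ f))
      = cutNear ((ℓ + 1) ^ i.k) i.P S (pull (Nat.one_le_pow i.k (ℓ + 1) (Nat.succ_pos ℓ)) i.hP i.hboxΩ R f) :=
  cutNear_congr fun z hz => by
    rw [fld_regionOp_pull F (Nat.one_le_pow i.k (ℓ + 1) (Nat.succ_pos ℓ)) i.hP i.h3 i.hboxΩ R i.e i.aK i.m2 i.Ac _ z (hz.isInt hSR),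
      HT_mulVec_GT i F ha hℓ, fld_pull]

/-- the near part of `H̃₀(G₀ g ∘ π)` is the near part of `g∘π`. [cite: Balaban1983RegularityDecay, (1.6) p.572 «periodic conditions»] -/
theorem cutNear_H₀L_pull (ha : 0 < amin) (hℓ : 1 ≤ ℓ) {S R : ℕ} (hSR : S + 1 ≤ R)
    (g : ↥(fineDom ((ℓ + 1) ^ i.k) i.Ω₀T) × ι → ℝ) :
    cutNear ((ℓ + 1) ^ i.k) i.P S (H₀L i F R *ᵥ pull (Nat.one_le_pow i.k (ℓ + 1) (Nat.succ_pos ℓ)) i.hP i.hbox R (i.G₀T F *ᵥ g))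
      = cutNear ((ℓ + 1) ^ i.k) i.P S (pull (Nat.one_le_pow i.k (ℓ + 1) (Nat.succ_pos ℓ)) i.hP i.hbox R g) :=
  cutNear_congr fun z hz => by
    rw [fld_regionOp_pull F (Nat.one_le_pow i.k (ℓ + 1) (Nat.succ_pos ℓ)) i.hP i.h3 i.hbox R i.e i.aK i.m2 i.Ac _ z (hz.isInt hSR),
      H₀T_mulVec_G₀T i F ha hℓ, fld_pull]

/-- THE SUP-NORM SIZE CONSTANT `4(d+1)n² + m² + a_k` of `H̃`. [cite: Balaban1983RegularityDecay, (1.3)–(1.6) p.572, dictionary] -/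
def CH : ℝ := 4 * ((d : ℝ) + 1) * (((ℓ + 1) ^ i.k : ℕ) : ℝ) ^ 2 + i.m2 + i.aK

/-- `CH ≥ 0`. [cite: Balaban1983RegularityDecay, (1.6) p.572, dictionary] -/
theorem CH_nonneg (ha : 0 < amin) (hℓ : 1 ≤ ℓ) : 0 ≤ CH i := by
  unfold CH
  have := aK_nonneg i ha hℓ
  have := i.hm1
  positivity

/-- `‖H̃Φ‖_∞ ≤ C_H‖Φ‖_∞` on the lift. [cite: Balaban1983RegularityDecay, (1.3)–(1.6) p.572] -/
theorem supN_HL_le (ha : 0 < amin) (hℓ : 1 ≤ ℓ) (R : ℕ)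
    (Φ : ↥(fineDom ((ℓ + 1) ^ i.k) (liftLabels i.P R i.ΩT)) × ι → ℝ) : supN (HL i F R *ᵥ Φ) ≤ CH i * supN Φ :=
  supN_le (mul_nonneg (CH_nonneg i ha hℓ) (supN_nonneg Φ)) fun z =>
    siteNorm_fld_regionOp_le (Nat.one_le_pow i.k (ℓ + 1) (Nat.succ_pos ℓ)) F i.e (aK_nonneg i ha hℓ) i.hm1 _ _ Φ z

/-- `‖H̃₀Φ‖_∞ ≤ C_H‖Φ‖_∞` on the lift of `Ω₀`. [cite: Balaban1983RegularityDecay, (1.3)–(1.6) p.572] -/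
theorem supN_H₀L_le (ha : 0 < amin) (hℓ : 1 ≤ ℓ) (R : ℕ)
    (Φ : ↥(fineDom ((ℓ + 1) ^ i.k) (liftLabels i.P R i.Ω₀T)) × ι → ℝ) : supN (H₀L i F R *ᵥ Φ) ≤ CH i * supN Φ :=
  supN_le (mul_nonneg (CH_nonneg i ha hℓ) (supN_nonneg Φ)) fun z =>
    siteNorm_fld_regionOp_le (Nat.one_le_pow i.k (ℓ + 1) (Nat.succ_pos ℓ)) F i.e (aK_nonneg i ha hℓ) i.hm1 _ _ Φ z

omit [Fintype ι] [DecidableEq ι] in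
/-- the extension by zero of the lifted instance, evaluated. [cite: Balaban1983RegularityDecay, (1.11) p.573, dictionary] -/
theorem extR_liftInst_apply (R : ℕ) (g : ↥(fineDom ((ℓ + 1) ^ i.k) (liftLabels i.P R i.ΩT)) × ι → ℝ)
    (y : Fin (d + 1) → ℤ) (hy : y ∈ fineDom ((ℓ + 1) ^ i.k) (liftLabels i.P R i.Ω₀T)) (jj : ι) :
    (i.liftInst R).extR g (⟨y, hy⟩, jj)
      = if h : blk ((ℓ + 1) ^ i.k) y ∈ liftLabels i.P R i.ΩT
        then g (⟨y, (mem_fineDom (Nat.one_le_pow i.k (ℓ + 1) (Nat.succ_pos ℓ))).2 h⟩, jj) else 0 := rfl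

omit [Fintype ι] [DecidableEq ι] in
/-- **EXTENSION BY ZERO COMMUTES WITH THE LIFT ON NEAR SOURCES**: `E(near part of f∘π) = near part of (Ef)∘π`
(`S ≤ R`). [cite: Balaban1983RegularityDecay, (1.11) p.573 «periodic conditions», dictionary] -/
theorem extR_cutNear_pull {S R : ℕ} (hSR : S ≤ R) (f : ↥(fineDom ((ℓ + 1) ^ i.k) i.ΩT) × ι → ℝ) :
    (i.liftInst R).extR (cutNear ((ℓ + 1) ^ i.k) i.P S (Ω' := liftLabels i.P R i.ΩT) (pull (Nat.one_le_pow i.k (ℓ + 1) (Nat.succ_pos ℓ)) i.hP i.hboxΩ R f))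
      = cutNear ((ℓ + 1) ^ i.k) i.P S (Ω' := liftLabels i.P R i.Ω₀T) (pull (Nat.one_le_pow i.k (ℓ + 1) (Nat.succ_pos ℓ)) i.hP i.hbox R (i.extT f)) := by
  funext p
  obtain ⟨⟨y, hy⟩, jj⟩ := p
  have hyL : y ∈ fineDom ((ℓ + 1) ^ i.k) (liftLabels i.P R i.Ω₀T) := hy
  show (i.liftInst R).extR (cutNear ((ℓ + 1) ^ i.k) i.P S (Ω' := liftLabels i.P R i.ΩT)
      (pull (Nat.one_le_pow i.k (ℓ + 1) (Nat.succ_pos ℓ)) i.hP i.hboxΩ R f)) (⟨y, hyL⟩, jj)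
    = cutNear ((ℓ + 1) ^ i.k) i.P S (Ω' := liftLabels i.P R i.Ω₀T)
      (pull (Nat.one_le_pow i.k (ℓ + 1) (Nat.succ_pos ℓ)) i.hP i.hbox R (i.extT f)) (⟨y, hyL⟩, jj)
  rw [extR_liftInst_apply]
  by_cases hp : Near ((ℓ + 1) ^ i.k) i.P S y
  · rw [cutNear_of_near (pull (Nat.one_le_pow i.k (ℓ + 1) (Nat.succ_pos ℓ)) i.hP i.hbox R (i.extT f)) (p := (⟨y, hyL⟩, jj)) hp]
    have hiff : blk ((ℓ + 1) ^ i.k) y ∈ liftLabels i.P R i.ΩT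
        ↔ blk ((ℓ + 1) ^ i.k) (twrap ((ℓ + 1) ^ i.k) i.P y) ∈ i.ΩT := by
      rw [mem_liftLabels_iff i.hP i.hboxΩ, blk_twrap (Nat.one_le_pow i.k (ℓ + 1) (Nat.succ_pos ℓ))]
      exact ⟨fun h => h.1, fun h => ⟨h, fun ν => (hp ν).trans (by exact_mod_cast hSR)⟩⟩
    by_cases hq : blk ((ℓ + 1) ^ i.k) (twrap ((ℓ + 1) ^ i.k) i.P y) ∈ i.ΩT
    · rw [dif_pos (hiff.2 hq)]
      have hmem : (⟨y, (mem_fineDom (Nat.one_le_pow i.k (ℓ + 1) (Nat.succ_pos ℓ))).2 (hiff.2 hq)⟩ : ↥(fineDom ((ℓ + 1) ^ i.k) (liftLabels i.P R i.ΩT))).1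
          ∈ fineDom ((ℓ + 1) ^ i.k) (liftLabels i.P R i.ΩT) := (mem_fineDom (Nat.one_le_pow i.k (ℓ + 1) (Nat.succ_pos ℓ))).2 (hiff.2 hq)
      rw [cutNear_of_near (pull (Nat.one_le_pow i.k (ℓ + 1) (Nat.succ_pos ℓ)) i.hP i.hboxΩ R f)
        (p := ((⟨y, (mem_fineDom (Nat.one_le_pow i.k (ℓ + 1) (Nat.succ_pos ℓ))).2 (hiff.2 hq)⟩ :
          ↥(fineDom ((ℓ + 1) ^ i.k) (liftLabels i.P R i.ΩT))), jj)) hp]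
      show f (proj (Nat.one_le_pow i.k (ℓ + 1) (Nat.succ_pos ℓ)) i.hP i.hboxΩ R ⟨y, (mem_fineDom (Nat.one_le_pow i.k (ℓ + 1) (Nat.succ_pos ℓ))).2 (hiff.2 hq)⟩, jj)
        = i.extT f (proj (Nat.one_le_pow i.k (ℓ + 1) (Nat.succ_pos ℓ)) i.hP i.hbox R ⟨y, hyL⟩, jj)
      rw [i.extT_of_mem f _ (by exact hq)]
      rfl
    · rw [dif_neg (fun h => hq (hiff.1 h))]
      show (0 : ℝ) = i.extT f (proj (Nat.one_le_pow i.k (ℓ + 1) (Nat.succ_pos ℓ)) i.hP i.hbox R ⟨y, hyL⟩, jj)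
      rw [i.extT_of_not_mem f _ (by exact hq)]
  · rw [cutNear_of_not_near (pull (Nat.one_le_pow i.k (ℓ + 1) (Nat.succ_pos ℓ)) i.hP i.hbox R (i.extT f)) (p := (⟨y, hyL⟩, jj)) hp]
    split_ifs with h
    · exact cutNear_of_not_near _ (by exact hp)
    · rfl

/-- **LATTICE DISTANCES TO THE COMPLEMENT DOMINATE** (raw form, for the lift of `Ω′ ⊇ Ω`): a number `D` below
`dist_T(x, Ω^c)` for the torus site under `ỹ` (or `Ω` the whole torus) and below `R − t`, `ỹ` in copies `≤ t`, is
below `|ỹ − z|_∞/n` for every fine point `z` outside the lift of `Ω′`. [cite: Balaban1983RegularityDecay, Theorem p.573 «dist(x, Ω^c) ≥ R₀», p.572 «periodic conditions»] -/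
theorem le_dist_compl_lift {Ω' : Finset (Fin (d + 1) → ℤ)} (hΩ' : Ω' ⊆ boxDom i.P)
    (hTΩ' : fineDom ((ℓ + 1) ^ i.k) i.ΩT ⊆ fineDom ((ℓ + 1) ^ i.k) Ω') (R : ℕ) (yb : Fin (d + 1) → ℤ) {t : ℕ}
    (ht : Near ((ℓ + 1) ^ i.k) i.P t yb) {D : ℝ}
    (hDc : fineDom ((ℓ + 1) ^ i.k) i.ΩT = boxDom (per ((ℓ + 1) ^ i.k) i.P) ∨
      ∃ x : ↥(fineDom ((ℓ + 1) ^ i.k) i.ΩT), x.1 = twrap ((ℓ + 1) ^ i.k) i.P yb ∧ D ≤ tcdist i.P x)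
    (hDR : D ≤ (R : ℝ) - t) (z : Fin (d + 1) → ℤ) (hz : z ∉ fineDom ((ℓ + 1) ^ i.k) (liftLabels i.P R Ω')) :
    D * (((ℓ + 1) ^ i.k : ℕ) : ℝ) ≤ supNorm (yb - z) := by
  have hnr := n_pos i
  rw [mem_fineDom_lift_iff (Nat.one_le_pow i.k (ℓ + 1) (Nat.succ_pos ℓ)) i.hP hΩ', not_and_or] at hz
  rcases hz with hz | hz
  · have hzT : twrap ((ℓ + 1) ^ i.k) i.P z ∉ fineDom ((ℓ + 1) ^ i.k) i.ΩT := fun h => hz (hTΩ' h)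
    have hzB : twrap ((ℓ + 1) ^ i.k) i.P z ∈ boxDom (per ((ℓ + 1) ^ i.k) i.P) :=
      twrap_mem_boxDom (Nat.one_le_pow i.k (ℓ + 1) (Nat.succ_pos ℓ)) i.hP z
    rcases hDc with hrect | ⟨x, hx, hD⟩
    · exact absurd (hrect ▸ hzB) hzT
    · have h1 := tcdist_le i.P x hzB hzT
      rw [hx, tnorm_twrap_sub_twrap] at h1
      have h2 := tnorm_le_supNorm (Nat.one_le_pow i.k (ℓ + 1) (Nat.succ_pos ℓ)) i.hP (yb - z)
      rw [le_div_iff₀ hnr] at h1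
      have h3 := mul_le_mul_of_nonneg_right hD hnr.le
      linarith
  · have h1 := far_dist (Nat.one_le_pow i.k (ℓ + 1) (Nat.succ_pos ℓ)) i.hP ht hz
    exact le_trans (mul_le_mul_of_nonneg_right hDR hnr.le) h1

/-- a point outside every lift: `n P (R+1)·𝟙`. [cite: Balaban1983RegularityDecay, p.572 «periodic conditions», dictionary] -/
theorem exists_not_mem_lift {Ω' : Finset (Fin (d + 1) → ℤ)} (hΩ' : Ω' ⊆ boxDom i.P) (R : ℕ) :
    ∃ z : Fin (d + 1) → ℤ, z ∉ fineDom ((ℓ + 1) ^ i.k) (liftLabels i.P R Ω') := by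
  refine ⟨fun ν => (((ℓ + 1) ^ i.k : ℕ) : ℤ) * ((i.P ν : ℤ) * (R + 1)), fun h => ?_⟩
  rw [mem_fineDom_lift_iff (Nat.one_le_pow i.k (ℓ + 1) (Nat.succ_pos ℓ)) i.hP hΩ', blk_mul (Nat.one_le_pow i.k (ℓ + 1) (Nat.succ_pos ℓ))] at h
  have h1 := h.2 0
  have hP0 : (i.P 0 : ℤ) ≠ 0 := by have := i.hP 0; omega
  simp only [cidx] at h1
  rw [Int.mul_ediv_cancel_left _ hP0] at h1
  have : ((R : ℤ) + 1 : ℤ) ≤ R := le_trans (le_abs_self _) h1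
  omega

/-- **`dist(x̃, Ω̃^c) ≥ D`** for a site of the lift in copies `≤ t`, whenever `D ≤ dist_T(πx̃, Ω^c)` (or `Ω` is the
whole torus) and `D ≤ R − t`. [cite: Balaban1983RegularityDecay, Theorem p.573 «dist(x, Ω^c) ≥ R₀», dictionary] -/
theorem le_cdist_lift (R : ℕ) (xL : ↥(fineDom ((ℓ + 1) ^ i.k) (liftLabels i.P R i.ΩT))) {t : ℕ}
    (ht : Near ((ℓ + 1) ^ i.k) i.P t xL.1) {D : ℝ}
    (hDc : fineDom ((ℓ + 1) ^ i.k) i.ΩT = boxDom (per ((ℓ + 1) ^ i.k) i.P) ∨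
      D ≤ tcdist i.P (proj (Nat.one_le_pow i.k (ℓ + 1) (Nat.succ_pos ℓ)) i.hP i.hboxΩ R xL))
    (hDR : D ≤ (R : ℝ) - t) : D ≤ (i.liftInst R).cdist xL :=
  lat_le_cdist (i.liftInst R) xL (exists_not_mem_lift i i.hboxΩ R) fun z hz =>
    le_dist_compl_lift i i.hboxΩ (Finset.Subset.refl _) R xL.1 ht
      (hDc.imp id fun h => ⟨proj (Nat.one_le_pow i.k (ℓ + 1) (Nat.succ_pos ℓ)) i.hP i.hboxΩ R xL, rfl, h⟩) hDR z hz

/-- `dist(ỹ, Ω̃₀^c) ≥ D` for a site of the lift of `Ω₀` in copies `≤ t` lying over a site `x` of `Ω`, whenever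
`D ≤ dist_T(x, Ω^c)` (or `Ω` is the whole torus) and `D ≤ R − t`. [cite: Balaban1983RegularityDecay, Theorem p.573, dictionary] -/
theorem le_cdist_lift₀ (R : ℕ) (yL : ↥(fineDom ((ℓ + 1) ^ i.k) (liftLabels i.P R i.Ω₀T))) {t : ℕ}
    (ht : Near ((ℓ + 1) ^ i.k) i.P t yL.1) {D : ℝ}
    (hDc : fineDom ((ℓ + 1) ^ i.k) i.ΩT = boxDom (per ((ℓ + 1) ^ i.k) i.P) ∨
      ∃ x : ↥(fineDom ((ℓ + 1) ^ i.k) i.ΩT), x.1 = twrap ((ℓ + 1) ^ i.k) i.P yL.1 ∧ D ≤ tcdist i.P x)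
    (hDR : D ≤ (R : ℝ) - t) : D ≤ (i.liftInst₀ R).cdist yL :=
  lat_le_cdist (i.liftInst₀ R) yL (exists_not_mem_lift i i.hbox R) fun z hz =>
    le_dist_compl_lift i i.hbox (fineDom_mono (Nat.one_le_pow i.k (ℓ + 1) (Nat.succ_pos ℓ)) i.hsub) R yL.1 ht hDc hDR z hz

omit [DecidableEq ι] in
/-- a site in the support of the near part of `f∘π` is near and lies over the support of `f`.
[cite: Balaban1983RegularityDecay, (1.9) p.573 «supp f», dictionary] -/
theorem supp_cutNear_pull (R S : ℕ) (f : ↥(fineDom ((ℓ + 1) ^ i.k) i.ΩT) × ι → ℝ)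
    (z : ↥(fineDom ((ℓ + 1) ^ i.k) (liftLabels i.P R i.ΩT)))
    (hz : z ∈ (i.liftInst R).supp
      (cutNear ((ℓ + 1) ^ i.k) i.P S (Ω' := liftLabels i.P R i.ΩT) (pull (Nat.one_le_pow i.k (ℓ + 1) (Nat.succ_pos ℓ)) i.hP i.hboxΩ R f))) :
    Near ((ℓ + 1) ^ i.k) i.P S z.1 ∧ proj (Nat.one_le_pow i.k (ℓ + 1) (Nat.succ_pos ℓ)) i.hP i.hboxΩ R z ∈ tsupp f := by
  obtain ⟨jj, hjj⟩ := (lat_mem_supp (i.liftInst R)).1 hz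
  obtain ⟨hnear, hne⟩ := near_of_cutNear_ne _ hjj
  exact ⟨hnear, mem_tsupp_of_ne f hne⟩

omit [DecidableEq ι] in
/-- **LATTICE DISTANCES TO A NEAR SOURCE DOMINATE THE TORUS DISTANCE TO THE SOURCE**: for `z̃` in the support of the
near part of `f∘π`, `n·dist_T(πx̃, supp f) ≤ |x̃ − z̃|_∞`. [cite: Balaban1983RegularityDecay, (1.10) p.573 «dist(x, supp f)», dictionary] -/
theorem tsdist1_le_of_supp_cutNear (R S : ℕ) (f : ↥(fineDom ((ℓ + 1) ^ i.k) i.ΩT) × ι → ℝ)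
    (xL : ↥(fineDom ((ℓ + 1) ^ i.k) (liftLabels i.P R i.ΩT)))
    (z : ↥(fineDom ((ℓ + 1) ^ i.k) (liftLabels i.P R i.ΩT)))
    (hz : z ∈ (i.liftInst R).supp
      (cutNear ((ℓ + 1) ^ i.k) i.P S (Ω' := liftLabels i.P R i.ΩT) (pull (Nat.one_le_pow i.k (ℓ + 1) (Nat.succ_pos ℓ)) i.hP i.hboxΩ R f))) :
    tsdist1 i.P (proj (Nat.one_le_pow i.k (ℓ + 1) (Nat.succ_pos ℓ)) i.hP i.hboxΩ R xL) f * (((ℓ + 1) ^ i.k : ℕ) : ℝ) ≤ supNorm (xL.1 - z.1) := by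
  have hnr := n_pos i
  obtain ⟨jj, hjj⟩ := (lat_mem_supp (i.liftInst R)).1 hz
  obtain ⟨-, hne⟩ := near_of_cutNear_ne _ hjj
  have hmem : proj (Nat.one_le_pow i.k (ℓ + 1) (Nat.succ_pos ℓ)) i.hP i.hboxΩ R z ∈ tsupp f := mem_tsupp_of_ne f hne
  have h1 := tsdist1_le i.P (proj (Nat.one_le_pow i.k (ℓ + 1) (Nat.succ_pos ℓ)) i.hP i.hboxΩ R xL) f hmem
  rw [proj_val, proj_val, tnorm_twrap_sub_twrap, le_div_iff₀ hnr] at h1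
  exact h1.trans (tnorm_le_supNorm (Nat.one_le_pow i.k (ℓ + 1) (Nat.succ_pos ℓ)) i.hP _)

omit [DecidableEq ι] in
/-- far sources are far: for `z̃` in the support of the far part of a source and `x̃` in copies `≤ t`,
`n(S − t) ≤ |x̃ − z̃|_∞`. [cite: Balaban1983RegularityDecay, p.572 «periodic conditions», dictionary] -/
theorem far_le_of_supp_sub_cutNear (j : RegionPairInst d ℓ amin aplus m2plus) (S t : ℕ)
    (g : ↥(fineDom ((ℓ + 1) ^ j.k) j.Ωc) × ι → ℝ) (xL z : ↥(fineDom ((ℓ + 1) ^ j.k) j.Ωc))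
    (ht : Near ((ℓ + 1) ^ j.k) i.P t xL.1) (hz : z ∈ j.supp (g - cutNear ((ℓ + 1) ^ j.k) i.P S g)) :
    ((S : ℝ) - t) * (((ℓ + 1) ^ j.k : ℕ) : ℝ) ≤ supNorm (xL.1 - z.1) := by
  obtain ⟨jj, hjj⟩ := (lat_mem_supp j).1 hz
  exact far_dist (Nat.one_le_pow j.k (ℓ + 1) (Nat.succ_pos ℓ)) i.hP ht (not_near_of_sub_cutNear_ne g hjj)

end LiftData

/-! ## §3. The members on the torus family, by lifting -/

section Members

open LiftData

variable {ℓ : ℕ} {amin aplus m2plus : ℝ} (i : TorusPairInst d ℓ amin aplus m2plus) (F : OrthFlow ι)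
  {α δ₀ c₀ R₀ : ℝ}

/-- **THE VALUE-TYPE MEMBERS BY LIFTING** (generic in the evaluation operator `M`: identity or `D_μ`): if `M̃` on the
lifts intertwines with `M` on the torus at interior sites, and the lattice Theorem bounds `|(M̃G̃g)(x̃)|` by
`c₀e^{−δ₀dist(x̃, supp g)}‖g‖_∞` at sites with `dist(x̃, Ω̃^c) ≥ R₀`, then `|(MG f)(x)| ≤ c₀e^{−δ₀dist_T(x, supp f)}‖f‖_∞`
at torus sites with `dist_T(x, Ω^c) ≥ R₀` (or `Ω = T_η`). [cite: Balaban1983RegularityDecay, (1.10) p.573 «operators on subsets of a torus T_η»] -/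
theorem member_val (ha : 0 < amin) (hℓ : 1 ≤ ℓ) (hδ : 0 < δ₀) (hc : 0 < c₀)
    (MT : Matrix (↥(fineDom ((ℓ + 1) ^ i.k) i.ΩT) × ι) (↥(fineDom ((ℓ + 1) ^ i.k) i.ΩT) × ι) ℝ)
    (ML : ∀ R : ℕ, Matrix (↥(fineDom ((ℓ + 1) ^ i.k) (liftLabels i.P R i.ΩT)) × ι)
      (↥(fineDom ((ℓ + 1) ^ i.k) (liftLabels i.P R i.ΩT)) × ι) ℝ)
    (hM : ∀ (R : ℕ) (u : ↥(fineDom ((ℓ + 1) ^ i.k) i.ΩT) × ι → ℝ)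
      (xL : ↥(fineDom ((ℓ + 1) ^ i.k) (liftLabels i.P R i.ΩT))), IsInt ((ℓ + 1) ^ i.k) i.P R xL.1 →
      fld (ML R *ᵥ pull (Nat.one_le_pow i.k (ℓ + 1) (Nat.succ_pos ℓ)) i.hP i.hboxΩ R u) xL = fld (MT *ᵥ u) (proj (Nat.one_le_pow i.k (ℓ + 1) (Nat.succ_pos ℓ)) i.hP i.hboxΩ R xL))
    (hlat : ∀ (R : ℕ) (g : ↥(fineDom ((ℓ + 1) ^ i.k) (liftLabels i.P R i.ΩT)) × ι → ℝ)
      (xL : ↥(fineDom ((ℓ + 1) ^ i.k) (liftLabels i.P R i.ΩT))), R₀ ≤ (i.liftInst R).cdist xL →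
      siteNorm (fld (ML R *ᵥ ((HL i F R)⁻¹ *ᵥ g)) xL)
        ≤ c₀ * Real.exp (-(δ₀ * (i.liftInst R).sdist1 xL g)) * supN g)
    (f : ↥(fineDom ((ℓ + 1) ^ i.k) i.ΩT) × ι → ℝ) (x : ↥(fineDom ((ℓ + 1) ^ i.k) i.ΩT))
    (hx : fineDom ((ℓ + 1) ^ i.k) i.ΩT = boxDom (per ((ℓ + 1) ^ i.k) i.P) ∨ R₀ ≤ tcdist i.P x) :
    siteNorm (fld (MT *ᵥ (i.GT F *ᵥ f)) x) ≤ c₀ * Real.exp (-(δ₀ * tsdist1 i.P x f)) * supN f := by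
  set u := i.GT F *ᵥ f with hu
  refine le_of_forall_exp_tail hδ (max R₀ 0) (c := c₀ * (supN f + CH i * supN u)) fun S hS => ?_
  have hSR₀ : R₀ ≤ S := (le_max_left _ _).trans hS
  set R : ℕ := 2 * S + 2 with hR
  have hSR : S + 1 ≤ R := by omega
  have hRS : (S : ℝ) ≤ R := by rw [hR]; push_cast; linarith
  -- the copy-`0` lift of `x`
  set xL := base i R x with hxL
  have hnear0 : Near ((ℓ + 1) ^ i.k) i.P 0 xL.1 := near_base i R x
  have hint0 : IsInt ((ℓ + 1) ^ i.k) i.P R xL.1 := hnear0.isInt (by omega)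
  have hproj : proj (Nat.one_le_pow i.k (ℓ + 1) (Nat.succ_pos ℓ)) i.hP i.hboxΩ R xL = x := proj_base i R x
  have hcd : R₀ ≤ (i.liftInst R).cdist xL :=
    le_cdist_lift i R xL hnear0 (hx.imp id fun h => by rw [hproj]; exact h)
      (by simp only [Nat.cast_zero, sub_zero]; linarith)
  -- the source on the lift and its near and far parts
  set w := HL i F R *ᵥ pull (Nat.one_le_pow i.k (ℓ + 1) (Nat.succ_pos ℓ)) i.hP i.hboxΩ R u with hw
  set wN := cutNear ((ℓ + 1) ^ i.k) i.P S w with hwN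
  have hwN' : wN = cutNear ((ℓ + 1) ^ i.k) i.P S (pull (Nat.one_le_pow i.k (ℓ + 1) (Nat.succ_pos ℓ)) i.hP i.hboxΩ R f) := by
    rw [hwN, hw, hu]; exact cutNear_HL_pull i F ha hℓ hSR f
  -- the value splits
  have hsplit : fld (MT *ᵥ u) x
      = fld (ML R *ᵥ ((HL i F R)⁻¹ *ᵥ wN)) xL + fld (ML R *ᵥ ((HL i F R)⁻¹ *ᵥ (w - wN))) xL := by
    have h1 : fld (MT *ᵥ u) x = fld (ML R *ᵥ pull (Nat.one_le_pow i.k (ℓ + 1) (Nat.succ_pos ℓ)) i.hP i.hboxΩ R u) xL := by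
      rw [hM R u xL hint0, hproj]
    have h2 : pull (Nat.one_le_pow i.k (ℓ + 1) (Nat.succ_pos ℓ)) i.hP i.hboxΩ R u = (HL i F R)⁻¹ *ᵥ wN + (HL i F R)⁻¹ *ᵥ (w - wN) := by
      rw [← Matrix.mulVec_add, add_sub_cancel, hw]
      exact pull_eq i F ha hℓ R u
    rw [h1, h2, Matrix.mulVec_add]
    rfl
  -- the near piece: the printed right-hand side
  have hmain : siteNorm (fld (ML R *ᵥ ((HL i F R)⁻¹ *ᵥ wN)) xL)
      ≤ c₀ * Real.exp (-(δ₀ * tsdist1 i.P x f)) * supN f := by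
    refine lat_decay_transfer (i.liftInst R) xL wN hc.le hδ.le ?_ (hlat R wN xL hcd) ?_ ?_
    · rw [hwN']
      exact (supN_cutNear_le _).trans (supN_pull_le (Nat.one_le_pow i.k (ℓ + 1) (Nat.succ_pos ℓ)) i.hP i.hboxΩ R f)
    · intro h
      have h0 : wN = 0 := funext h
      rw [h0, Matrix.mulVec_zero, Matrix.mulVec_zero]; rfl
    · intro z hz
      rw [hwN'] at hz
      have := tsdist1_le_of_supp_cutNear i R S f xL z hz
      rwa [hproj] at this
  -- the far piece: a vanishing tail
  have htail : siteNorm (fld (ML R *ᵥ ((HL i F R)⁻¹ *ᵥ (w - wN))) xL)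
      ≤ c₀ * Real.exp (-(δ₀ * S)) * (supN f + CH i * supN u) := by
    refine lat_decay_transfer (i.liftInst R) xL (w - wN) hc.le hδ.le ?_ (hlat R (w - wN) xL hcd) ?_ ?_
    · calc supN (w - wN) ≤ supN w := supN_sub_cutNear_le _
        _ ≤ CH i * supN (pull (Nat.one_le_pow i.k (ℓ + 1) (Nat.succ_pos ℓ)) i.hP i.hboxΩ R u) := supN_HL_le i F ha hℓ R _
        _ ≤ CH i * supN u := mul_le_mul_of_nonneg_left (supN_pull_le _ _ _ R u) (CH_nonneg i ha hℓ)
        _ ≤ supN f + CH i * supN u := le_add_of_nonneg_left (supN_nonneg f)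
    · intro h
      have h0 : w - wN = 0 := funext h
      rw [h0, Matrix.mulVec_zero, Matrix.mulVec_zero]; rfl
    · intro z hz
      have := far_le_of_supp_sub_cutNear i (i.liftInst R) S 0 w xL z hnear0 hz
      simpa using this
  calc siteNorm (fld (MT *ᵥ u) x)
      = siteNorm (fld (ML R *ᵥ ((HL i F R)⁻¹ *ᵥ wN)) xL + fld (ML R *ᵥ ((HL i F R)⁻¹ *ᵥ (w - wN))) xL) := by
        rw [hsplit]
    _ ≤ _ := siteNorm_add_le _ _
    _ ≤ c₀ * Real.exp (-(δ₀ * tsdist1 i.P x f)) * supN f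
          + c₀ * Real.exp (-(δ₀ * S)) * (supN f + CH i * supN u) := add_le_add hmain htail
    _ = c₀ * Real.exp (-(δ₀ * tsdist1 i.P x f)) * supN f
          + c₀ * (supN f + CH i * supN u) * Real.exp (-(δ₀ * S)) := by ring

variable {creg β : ℝ} {K : ℕ}

/-- the lattice member «(1.10), value» at a lifted instance, for the identity evaluation operator.
[cite: Balaban1983RegularityDecay, (1.10) p.573] -/
theorem lat_valG (R : ℕ)
    (H : Ineq19_110 (regionPairFam F d ℓ amin aplus m2plus creg β K (i.liftInst R)) α δ₀ c₀ R₀)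
    (g : ↥(fineDom ((ℓ + 1) ^ i.k) (liftLabels i.P R i.ΩT)) × ι → ℝ)
    (xL : ↥(fineDom ((ℓ + 1) ^ i.k) (liftLabels i.P R i.ΩT))) (h : R₀ ≤ (i.liftInst R).cdist xL) :
    siteNorm (fld ((1 : Matrix (↥(fineDom ((ℓ + 1) ^ i.k) (liftLabels i.P R i.ΩT)) × ι)
        (↥(fineDom ((ℓ + 1) ^ i.k) (liftLabels i.P R i.ΩT)) × ι) ℝ) *ᵥ ((HL i F R)⁻¹ *ᵥ g)) xL)
      ≤ c₀ * Real.exp (-(δ₀ * (i.liftInst R).sdist1 xL g)) * supN g := by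
  rw [Matrix.one_mulVec]
  exact (H.2 (0 : Fin (d + 1)) g xL (Or.inr h)).2

/-- the lattice member «(1.10), derivative» at a lifted instance. [cite: Balaban1983RegularityDecay, (1.10) p.573] -/
theorem lat_valDG (R : ℕ)
    (H : Ineq19_110 (regionPairFam F d ℓ amin aplus m2plus creg β K (i.liftInst R)) α δ₀ c₀ R₀)
    (μ : Fin (d + 1)) (g : ↥(fineDom ((ℓ + 1) ^ i.k) (liftLabels i.P R i.ΩT)) × ι → ℝ)
    (xL : ↥(fineDom ((ℓ + 1) ^ i.k) (liftLabels i.P R i.ΩT))) (h : R₀ ≤ (i.liftInst R).cdist xL) :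
    siteNorm (fld (DL i F R μ *ᵥ ((HL i F R)⁻¹ *ᵥ g)) xL)
      ≤ c₀ * Real.exp (-(δ₀ * (i.liftInst R).sdist1 xL g)) * supN g :=
  (H.2 μ g xL (Or.inr h)).1

/-- the lattice member «(1.10), value» at the instance `Ω̃₀ ⊂ Ω̃₀`. [cite: Balaban1983RegularityDecay, (1.10) p.573] -/
theorem lat_valG₀ (R : ℕ)
    (H : Ineq19_110 (regionPairFam F d ℓ amin aplus m2plus creg β K (i.liftInst₀ R)) α δ₀ c₀ R₀)
    (g : ↥(fineDom ((ℓ + 1) ^ i.k) (liftLabels i.P R i.Ω₀T)) × ι → ℝ)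
    (yL : ↥(fineDom ((ℓ + 1) ^ i.k) (liftLabels i.P R i.Ω₀T))) (h : R₀ ≤ (i.liftInst₀ R).cdist yL) :
    siteNorm (fld ((1 : Matrix (↥(fineDom ((ℓ + 1) ^ i.k) (liftLabels i.P R i.Ω₀T)) × ι)
        (↥(fineDom ((ℓ + 1) ^ i.k) (liftLabels i.P R i.Ω₀T)) × ι) ℝ) *ᵥ ((H₀L i F R)⁻¹ *ᵥ g)) yL)
      ≤ c₀ * Real.exp (-(δ₀ * (i.liftInst₀ R).sdist1 yL g)) * supN g := by
  rw [Matrix.one_mulVec]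
  exact (H.2 (0 : Fin (d + 1)) g yL (Or.inr h)).2

/-- the lattice member «(1.10), derivative» at the instance `Ω̃₀ ⊂ Ω̃₀`. [cite: Balaban1983RegularityDecay, (1.10) p.573] -/
theorem lat_valDG₀ (R : ℕ)
    (H : Ineq19_110 (regionPairFam F d ℓ amin aplus m2plus creg β K (i.liftInst₀ R)) α δ₀ c₀ R₀)
    (μ : Fin (d + 1)) (g : ↥(fineDom ((ℓ + 1) ^ i.k) (liftLabels i.P R i.Ω₀T)) × ι → ℝ)
    (yL : ↥(fineDom ((ℓ + 1) ^ i.k) (liftLabels i.P R i.Ω₀T))) (h : R₀ ≤ (i.liftInst₀ R).cdist yL) :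
    siteNorm (fld (D₀L i F R μ *ᵥ ((H₀L i F R)⁻¹ *ᵥ g)) yL)
      ≤ c₀ * Real.exp (-(δ₀ * (i.liftInst₀ R).sdist1 yL g)) * supN g :=
  (H.2 μ g yL (Or.inr h)).1

/-- **(1.10), VALUE, ON THE TORUS FAMILY**: `|(G_k(Ω,A)f)(x)| ≤ c₀e^{−δ₀dist_T(x, supp f)}‖f‖_∞` for `dist_T(x, Ω^c) ≥ R₀`
(or `Ω = T_η`). [cite: Balaban1983RegularityDecay, (1.10) p.573 «operators on subsets of a torus T_η»] -/
theorem valG_torus (ha : 0 < amin) (hℓ : 1 ≤ ℓ) (hδ : 0 < δ₀) (hc : 0 < c₀)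
    (HI : ∀ R : ℕ, Ineq19_110 (regionPairFam F d ℓ amin aplus m2plus creg β K (i.liftInst R)) α δ₀ c₀ R₀)
    (f : ↥(fineDom ((ℓ + 1) ^ i.k) i.ΩT) × ι → ℝ) (x : ↥(fineDom ((ℓ + 1) ^ i.k) i.ΩT))
    (hx : fineDom ((ℓ + 1) ^ i.k) i.ΩT = boxDom (per ((ℓ + 1) ^ i.k) i.P) ∨ R₀ ≤ tcdist i.P x) :
    siteNorm (fld (i.GT F *ᵥ f) x) ≤ c₀ * Real.exp (-(δ₀ * tsdist1 i.P x f)) * supN f := by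
  have h := member_val i F ha hℓ hδ hc 1 (fun R => 1)
    (fun R u xL _ => by rw [Matrix.one_mulVec, Matrix.one_mulVec, fld_pull])
    (fun R g xL h => lat_valG i F R (HI R) g xL h) f x hx
  rwa [Matrix.one_mulVec] at h

/-- **(1.10), DERIVATIVE, ON THE TORUS FAMILY**: `|(D^η_{A,μ}G_k(Ω,A)f)(x)| ≤ c₀e^{−δ₀dist_T(x, supp f)}‖f‖_∞` for
`dist_T(x, Ω^c) ≥ R₀` (or `Ω = T_η`). [cite: Balaban1983RegularityDecay, (1.10) p.573 «operators on subsets of a torus T_η»] -/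
theorem valDG_torus (ha : 0 < amin) (hℓ : 1 ≤ ℓ) (hδ : 0 < δ₀) (hc : 0 < c₀)
    (HI : ∀ R : ℕ, Ineq19_110 (regionPairFam F d ℓ amin aplus m2plus creg β K (i.liftInst R)) α δ₀ c₀ R₀)
    (μ : Fin (d + 1)) (f : ↥(fineDom ((ℓ + 1) ^ i.k) i.ΩT) × ι → ℝ) (x : ↥(fineDom ((ℓ + 1) ^ i.k) i.ΩT))
    (hx : fineDom ((ℓ + 1) ^ i.k) i.ΩT = boxDom (per ((ℓ + 1) ^ i.k) i.P) ∨ R₀ ≤ tcdist i.P x) :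
    siteNorm (fld (i.DT F μ *ᵥ (i.GT F *ᵥ f)) x) ≤ c₀ * Real.exp (-(δ₀ * tsdist1 i.P x f)) * supN f :=
  member_val i F ha hℓ hδ hc (i.DT F μ) (fun R => DL i F R μ)
    (fun R u xL hint => fld_regionDeriv_pull F (Nat.one_le_pow i.k (ℓ + 1) (Nat.succ_pos ℓ)) i.hP i.h3 i.hboxΩ R i.e i.Ac μ u xL hint)
    (fun R g xL h => lat_valDG i F R (HI R) μ g xL h) f x hx

/-- **THE `δG` VALUE-TYPE MEMBERS BY LIFTING** (generic in the evaluation operators `M` on `Ω`, `M₀` on `Ω₀`): the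
value `V = (MG_k(Ω,A)f)(x) − (M₀G_k(Ω₀,A)Ef)(x)` is bounded by the printed right-hand side of (1.10)×(1.12) at torus
sites with `dist_T(x, Ω^c) ≥ R₀` (or `Ω = T_η`), given the intertwining of `M̃, M̃₀` with `M, M₀`, the lattice members
«(1.10)» for `M̃G̃` on `Ω̃` and for `M̃₀G̃₀` on `Ω̃₀ ⊂ Ω̃₀`, and the lattice member «(1.11)–(1.12)» for
`(M̃G̃g)(x̃) − (M̃₀G̃₀Eg)(x̃)` (under a side condition at `x̃` met by the copy-`0` lift of `x`).
[cite: Balaban1983RegularityDecay, (1.11)–(1.12) p.573 «operators on subsets of a torus T_η»] -/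
theorem member_delta (ha : 0 < amin) (hℓ : 1 ≤ ℓ) (hδ : 0 < δ₀) (hc : 0 < c₀)
    (MT : Matrix (↥(fineDom ((ℓ + 1) ^ i.k) i.ΩT) × ι) (↥(fineDom ((ℓ + 1) ^ i.k) i.ΩT) × ι) ℝ)
    (M₀T : Matrix (↥(fineDom ((ℓ + 1) ^ i.k) i.Ω₀T) × ι) (↥(fineDom ((ℓ + 1) ^ i.k) i.Ω₀T) × ι) ℝ)
    (ML : ∀ R : ℕ, Matrix (↥(fineDom ((ℓ + 1) ^ i.k) (liftLabels i.P R i.ΩT)) × ι)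
      (↥(fineDom ((ℓ + 1) ^ i.k) (liftLabels i.P R i.ΩT)) × ι) ℝ)
    (M₀L : ∀ R : ℕ, Matrix (↥(fineDom ((ℓ + 1) ^ i.k) (liftLabels i.P R i.Ω₀T)) × ι)
      (↥(fineDom ((ℓ + 1) ^ i.k) (liftLabels i.P R i.Ω₀T)) × ι) ℝ)
    (side : ∀ R : ℕ, ↥(fineDom ((ℓ + 1) ^ i.k) (liftLabels i.P R i.ΩT)) → Prop)
    (hM : ∀ (R : ℕ) (u : ↥(fineDom ((ℓ + 1) ^ i.k) i.ΩT) × ι → ℝ)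
      (xL : ↥(fineDom ((ℓ + 1) ^ i.k) (liftLabels i.P R i.ΩT))), IsInt ((ℓ + 1) ^ i.k) i.P R xL.1 →
      fld (ML R *ᵥ pull (Nat.one_le_pow i.k (ℓ + 1) (Nat.succ_pos ℓ)) i.hP i.hboxΩ R u) xL = fld (MT *ᵥ u) (proj (Nat.one_le_pow i.k (ℓ + 1) (Nat.succ_pos ℓ)) i.hP i.hboxΩ R xL))
    (hM₀ : ∀ (R : ℕ) (u₀ : ↥(fineDom ((ℓ + 1) ^ i.k) i.Ω₀T) × ι → ℝ)
      (yL : ↥(fineDom ((ℓ + 1) ^ i.k) (liftLabels i.P R i.Ω₀T))), IsInt ((ℓ + 1) ^ i.k) i.P R yL.1 →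
      fld (M₀L R *ᵥ pull (Nat.one_le_pow i.k (ℓ + 1) (Nat.succ_pos ℓ)) i.hP i.hbox R u₀) yL = fld (M₀T *ᵥ u₀) (proj (Nat.one_le_pow i.k (ℓ + 1) (Nat.succ_pos ℓ)) i.hP i.hbox R yL))
    (hlat : ∀ (R : ℕ) (g : ↥(fineDom ((ℓ + 1) ^ i.k) (liftLabels i.P R i.ΩT)) × ι → ℝ)
      (xL : ↥(fineDom ((ℓ + 1) ^ i.k) (liftLabels i.P R i.ΩT))), R₀ ≤ (i.liftInst R).cdist xL →
      siteNorm (fld (ML R *ᵥ ((HL i F R)⁻¹ *ᵥ g)) xL)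
        ≤ c₀ * Real.exp (-(δ₀ * (i.liftInst R).sdist1 xL g)) * supN g)
    (hlat₀ : ∀ (R : ℕ) (g : ↥(fineDom ((ℓ + 1) ^ i.k) (liftLabels i.P R i.Ω₀T)) × ι → ℝ)
      (yL : ↥(fineDom ((ℓ + 1) ^ i.k) (liftLabels i.P R i.Ω₀T))), R₀ ≤ (i.liftInst₀ R).cdist yL →
      siteNorm (fld (M₀L R *ᵥ ((H₀L i F R)⁻¹ *ᵥ g)) yL)
        ≤ c₀ * Real.exp (-(δ₀ * (i.liftInst₀ R).sdist1 yL g)) * supN g)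
    (hlatδ : ∀ (R : ℕ) (g : ↥(fineDom ((ℓ + 1) ^ i.k) (liftLabels i.P R i.ΩT)) × ι → ℝ)
      (xL : ↥(fineDom ((ℓ + 1) ^ i.k) (liftLabels i.P R i.ΩT))), side R xL → R₀ ≤ (i.liftInst R).cdist xL →
      siteNorm (fld (ML R *ᵥ ((HL i F R)⁻¹ *ᵥ g)) xL
          - fld (M₀L R *ᵥ ((H₀L i F R)⁻¹ *ᵥ (i.liftInst R).extR g))
              (incl (Nat.one_le_pow i.k (ℓ + 1) (Nat.succ_pos ℓ)) (i.liftInst R).hsub xL))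
        ≤ c₀ * Real.exp (-(δ₀ * (i.liftInst R).sdist1 xL g))
          * Real.exp (-(δ₀ * (i.liftInst R).cdist xL + δ₀ * (i.liftInst R).bdistS g)) * supN g)
    (f : ↥(fineDom ((ℓ + 1) ^ i.k) i.ΩT) × ι → ℝ) (x : ↥(fineDom ((ℓ + 1) ^ i.k) i.ΩT))
    (hside : ∀ R, 1 ≤ R → side R (base i R x))
    (hx : fineDom ((ℓ + 1) ^ i.k) i.ΩT = boxDom (per ((ℓ + 1) ^ i.k) i.P) ∨ R₀ ≤ tcdist i.P x) {V : ι → ℝ}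
    (hV : V = fld (MT *ᵥ (i.GT F *ᵥ f)) x - fld (M₀T *ᵥ (i.G₀T F *ᵥ i.extT f)) (incl (Nat.one_le_pow i.k (ℓ + 1) (Nat.succ_pos ℓ)) i.hsub x)) :
    siteNorm V ≤ c₀ * Real.exp (-(δ₀ * tsdist1 i.P x f))
      * Real.exp (-(δ₀ * tcdist i.P x + δ₀ * tbdistS i.P f)) * supN f := by
  subst hV
  set u := i.GT F *ᵥ f with hu
  set u₀ := i.G₀T F *ᵥ i.extT f with hu₀
  refine le_of_forall_exp_tail hδ (max (max R₀ 0) (max (tcdist i.P x) (tbdistS i.P f)))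
    (c := c₀ * (CH i * supN u + CH i * supN u₀)) fun S hS => ?_
  have hSR₀ : R₀ ≤ S := ((le_max_left _ _).trans (le_max_left _ _)).trans hS
  have hSc : tcdist i.P x ≤ S := ((le_max_left _ _).trans (le_max_right _ _)).trans hS
  have hSb : tbdistS i.P f ≤ S := ((le_max_right _ _).trans (le_max_right _ _)).trans hS
  set R : ℕ := 2 * S + 2 with hR
  have hSR : S + 1 ≤ R := by omega
  have hRS : (R : ℝ) = 2 * S + 2 := by rw [hR]; push_cast; ring
  -- the copy-`0` lifts of `x`
  set xL := base i R x with hxL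
  set yL := base₀ i R (incl (Nat.one_le_pow i.k (ℓ + 1) (Nat.succ_pos ℓ)) i.hsub x) with hyL
  have hnear0 : Near ((ℓ + 1) ^ i.k) i.P 0 xL.1 := near_base i R x
  have hnear0' : Near ((ℓ + 1) ^ i.k) i.P 0 yL.1 := near_base₀ i R _
  have hint0 : IsInt ((ℓ + 1) ^ i.k) i.P R xL.1 := hnear0.isInt (by omega)
  have hint0' : IsInt ((ℓ + 1) ^ i.k) i.P R yL.1 := hnear0'.isInt (by omega)
  have hproj : proj (Nat.one_le_pow i.k (ℓ + 1) (Nat.succ_pos ℓ)) i.hP i.hboxΩ R xL = x := proj_base i R x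
  have hproj₀ : proj (Nat.one_le_pow i.k (ℓ + 1) (Nat.succ_pos ℓ)) i.hP i.hbox R yL = incl (Nat.one_le_pow i.k (ℓ + 1) (Nat.succ_pos ℓ)) i.hsub x := proj_base₀ i R _
  have hincl : (incl (Nat.one_le_pow i.k (ℓ + 1) (Nat.succ_pos ℓ)) (i.liftInst R).hsub xL :
      ↥(fineDom ((ℓ + 1) ^ i.k) (liftLabels i.P R i.Ω₀T))) = yL := rfl
  have hcd : R₀ ≤ (i.liftInst R).cdist xL :=
    le_cdist_lift i R xL hnear0 (hx.imp id fun h => by rw [hproj]; exact h)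
      (by simp only [Nat.cast_zero, sub_zero]; linarith)
  have hcd' : tcdist i.P x ≤ (i.liftInst R).cdist xL :=
    le_cdist_lift i R xL hnear0 (Or.inr (by rw [hproj])) (by simp only [Nat.cast_zero, sub_zero]; linarith)
  have hxrep : x.1 = twrap ((ℓ + 1) ^ i.k) i.P yL.1 := (twrap_eq_self (val_mem_perBox (Nat.one_le_pow i.k (ℓ + 1) (Nat.succ_pos ℓ)) i.hboxΩ x)).symm
  have hcd₀ : R₀ ≤ (i.liftInst₀ R).cdist yL :=
    le_cdist_lift₀ i R yL hnear0' (hx.imp id fun h => ⟨x, hxrep, h⟩)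
      (by simp only [Nat.cast_zero, sub_zero]; linarith)
  -- the sources on the lifts and their near and far parts
  set w := HL i F R *ᵥ pull (Nat.one_le_pow i.k (ℓ + 1) (Nat.succ_pos ℓ)) i.hP i.hboxΩ R u with hw
  set wN := cutNear ((ℓ + 1) ^ i.k) i.P S w with hwN
  set g := cutNear ((ℓ + 1) ^ i.k) i.P S (Ω' := liftLabels i.P R i.ΩT) (pull (Nat.one_le_pow i.k (ℓ + 1) (Nat.succ_pos ℓ)) i.hP i.hboxΩ R f) with hg
  have hwN' : wN = g := by rw [hwN, hw, hu, hg]; exact cutNear_HL_pull i F ha hℓ hSR f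
  set w₀ := H₀L i F R *ᵥ pull (Nat.one_le_pow i.k (ℓ + 1) (Nat.succ_pos ℓ)) i.hP i.hbox R u₀ with hw₀
  set w₀N := cutNear ((ℓ + 1) ^ i.k) i.P S w₀ with hw₀N
  have hw₀N' : w₀N = (i.liftInst R).extR g := by
    rw [hw₀N, hw₀, hu₀, cutNear_H₀L_pull i F ha hℓ hSR, hg, extR_cutNear_pull i (by omega) f]
  -- the value splits
  have hsplit₁ : fld (MT *ᵥ u) x
      = fld (ML R *ᵥ ((HL i F R)⁻¹ *ᵥ g)) xL + fld (ML R *ᵥ ((HL i F R)⁻¹ *ᵥ (w - wN))) xL := by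
    have h1 : fld (MT *ᵥ u) x = fld (ML R *ᵥ pull (Nat.one_le_pow i.k (ℓ + 1) (Nat.succ_pos ℓ)) i.hP i.hboxΩ R u) xL := by
      rw [hM R u xL hint0, hproj]
    have h2 : pull (Nat.one_le_pow i.k (ℓ + 1) (Nat.succ_pos ℓ)) i.hP i.hboxΩ R u = (HL i F R)⁻¹ *ᵥ g + (HL i F R)⁻¹ *ᵥ (w - wN) := by
      rw [← hwN', ← Matrix.mulVec_add, add_sub_cancel, hw]
      exact pull_eq i F ha hℓ R u
    rw [h1, h2, Matrix.mulVec_add]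
    rfl
  have hsplit₂ : fld (M₀T *ᵥ u₀) (incl (Nat.one_le_pow i.k (ℓ + 1) (Nat.succ_pos ℓ)) i.hsub x)
      = fld (M₀L R *ᵥ ((H₀L i F R)⁻¹ *ᵥ (i.liftInst R).extR g)) yL
        + fld (M₀L R *ᵥ ((H₀L i F R)⁻¹ *ᵥ (w₀ - w₀N))) yL := by
    have h1 : fld (M₀T *ᵥ u₀) (incl (Nat.one_le_pow i.k (ℓ + 1) (Nat.succ_pos ℓ)) i.hsub x) = fld (M₀L R *ᵥ pull (Nat.one_le_pow i.k (ℓ + 1) (Nat.succ_pos ℓ)) i.hP i.hbox R u₀) yL := by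
      rw [hM₀ R u₀ yL hint0', hproj₀]
    have h2 : pull (Nat.one_le_pow i.k (ℓ + 1) (Nat.succ_pos ℓ)) i.hP i.hbox R u₀
        = (H₀L i F R)⁻¹ *ᵥ (i.liftInst R).extR g + (H₀L i F R)⁻¹ *ᵥ (w₀ - w₀N) := by
      rw [← hw₀N', ← Matrix.mulVec_add, add_sub_cancel, hw₀]
      exact pull₀_eq i F ha hℓ R u₀
    rw [h1, h2, Matrix.mulVec_add]
    rfl
  have hsplit : fld (MT *ᵥ u) x - fld (M₀T *ᵥ u₀) (incl (Nat.one_le_pow i.k (ℓ + 1) (Nat.succ_pos ℓ)) i.hsub x)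
      = (fld (ML R *ᵥ ((HL i F R)⁻¹ *ᵥ g)) xL
          - fld (M₀L R *ᵥ ((H₀L i F R)⁻¹ *ᵥ (i.liftInst R).extR g))
              (incl (Nat.one_le_pow i.k (ℓ + 1) (Nat.succ_pos ℓ)) (i.liftInst R).hsub xL))
        + (fld (ML R *ᵥ ((HL i F R)⁻¹ *ᵥ (w - wN))) xL - fld (M₀L R *ᵥ ((H₀L i F R)⁻¹ *ᵥ (w₀ - w₀N))) yL) := by
    rw [hsplit₁, hsplit₂, hincl]; abel
  -- the near piece: the printed right-hand side
  have hmain : siteNorm (fld (ML R *ᵥ ((HL i F R)⁻¹ *ᵥ g)) xL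
        - fld (M₀L R *ᵥ ((H₀L i F R)⁻¹ *ᵥ (i.liftInst R).extR g))
            (incl (Nat.one_le_pow i.k (ℓ + 1) (Nat.succ_pos ℓ)) (i.liftInst R).hsub xL))
      ≤ c₀ * Real.exp (-(δ₀ * tsdist1 i.P x f)) * Real.exp (-(δ₀ * tcdist i.P x + δ₀ * tbdistS i.P f)) * supN f := by
    refine lat_decay_transfer₂ (i.liftInst R) xL g hc.le hδ.le ?_ (hlatδ R g xL (hside R (by omega)) hcd) ?_ ?_ hcd' ?_
    · rw [hg]
      exact (supN_cutNear_le _).trans (supN_pull_le (Nat.one_le_pow i.k (ℓ + 1) (Nat.succ_pos ℓ)) i.hP i.hboxΩ R f)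
    · intro h
      have h0 : g = 0 := funext h
      have h1 : (i.liftInst R).extR g = (0 : ↥(fineDom ((ℓ + 1) ^ i.k) (liftLabels i.P R i.Ω₀T)) × ι → ℝ) := by
        rw [h0]; exact lat_extR_zero _
      rw [h1, h0, Matrix.mulVec_zero, Matrix.mulVec_zero, Matrix.mulVec_zero, Matrix.mulVec_zero]
      exact sub_self _
    · intro z hz
      have := tsdist1_le_of_supp_cutNear i R S f xL z hz
      rwa [hproj] at this
    · intro z hz
      obtain ⟨hzN, hzs⟩ := supp_cutNear_pull i R S f z hz
      refine le_cdist_lift i R z hzN (Or.inr (tbdistS_le i.P f hzs)) ?_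
      rw [hRS]; linarith
  -- the two far pieces: vanishing tails
  have htail₁ : siteNorm (fld (ML R *ᵥ ((HL i F R)⁻¹ *ᵥ (w - wN))) xL)
      ≤ c₀ * Real.exp (-(δ₀ * S)) * (CH i * supN u) := by
    refine lat_decay_transfer (i.liftInst R) xL (w - wN) hc.le hδ.le ?_ (hlat R (w - wN) xL hcd) ?_ ?_
    · calc supN (w - wN) ≤ supN w := supN_sub_cutNear_le _
        _ ≤ CH i * supN (pull (Nat.one_le_pow i.k (ℓ + 1) (Nat.succ_pos ℓ)) i.hP i.hboxΩ R u) := supN_HL_le i F ha hℓ R _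
        _ ≤ CH i * supN u := mul_le_mul_of_nonneg_left (supN_pull_le _ _ _ R u) (CH_nonneg i ha hℓ)
    · intro h
      have h0 : w - wN = 0 := funext h
      rw [h0, Matrix.mulVec_zero, Matrix.mulVec_zero]; rfl
    · intro z hz
      have := far_le_of_supp_sub_cutNear i (i.liftInst R) S 0 w xL z hnear0 hz
      simpa using this
  have htail₂ : siteNorm (fld (M₀L R *ᵥ ((H₀L i F R)⁻¹ *ᵥ (w₀ - w₀N))) yL)
      ≤ c₀ * Real.exp (-(δ₀ * S)) * (CH i * supN u₀) := by
    refine lat_decay_transfer (i.liftInst₀ R) yL (w₀ - w₀N) hc.le hδ.le ?_ (hlat₀ R (w₀ - w₀N) yL hcd₀) ?_ ?_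
    · calc supN (w₀ - w₀N) ≤ supN w₀ := supN_sub_cutNear_le _
        _ ≤ CH i * supN (pull (Nat.one_le_pow i.k (ℓ + 1) (Nat.succ_pos ℓ)) i.hP i.hbox R u₀) := supN_H₀L_le i F ha hℓ R _
        _ ≤ CH i * supN u₀ := mul_le_mul_of_nonneg_left (supN_pull_le _ _ _ R u₀) (CH_nonneg i ha hℓ)
    · intro h
      have h0 : w₀ - w₀N = 0 := funext h
      rw [h0, Matrix.mulVec_zero, Matrix.mulVec_zero]; rfl
    · intro z hz
      have := far_le_of_supp_sub_cutNear i (i.liftInst₀ R) S 0 w₀ yL z hnear0' hz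
      simpa using this
  rw [hsplit]
  calc siteNorm (_ + _) ≤ _ := siteNorm_add_le _ _
    _ ≤ _ := add_le_add hmain ((siteNorm_sub_le _ _).trans (add_le_add htail₁ htail₂))
    _ = _ := by ring

/-- the lattice member «(1.11)–(1.12), value» at a lifted instance, identity evaluation operators.
[cite: Balaban1983RegularityDecay, (1.11)–(1.12) p.573] -/
theorem lat_dvalG (R : ℕ)
    (H : Ineq111_112 (regionPairFam F d ℓ amin aplus m2plus creg β K (i.liftInst R)) α δ₀ c₀ R₀)
    (g : ↥(fineDom ((ℓ + 1) ^ i.k) (liftLabels i.P R i.ΩT)) × ι → ℝ)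
    (xL : ↥(fineDom ((ℓ + 1) ^ i.k) (liftLabels i.P R i.ΩT))) (h : R₀ ≤ (i.liftInst R).cdist xL) :
    siteNorm (fld ((1 : Matrix (↥(fineDom ((ℓ + 1) ^ i.k) (liftLabels i.P R i.ΩT)) × ι)
        (↥(fineDom ((ℓ + 1) ^ i.k) (liftLabels i.P R i.ΩT)) × ι) ℝ) *ᵥ ((HL i F R)⁻¹ *ᵥ g)) xL
        - fld ((1 : Matrix (↥(fineDom ((ℓ + 1) ^ i.k) (liftLabels i.P R i.Ω₀T)) × ι)
            (↥(fineDom ((ℓ + 1) ^ i.k) (liftLabels i.P R i.Ω₀T)) × ι) ℝ)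
            *ᵥ ((H₀L i F R)⁻¹ *ᵥ (i.liftInst R).extR g))
            (incl (Nat.one_le_pow i.k (ℓ + 1) (Nat.succ_pos ℓ)) (i.liftInst R).hsub xL))
      ≤ c₀ * Real.exp (-(δ₀ * (i.liftInst R).sdist1 xL g))
        * Real.exp (-(δ₀ * (i.liftInst R).cdist xL + δ₀ * (i.liftInst R).bdistS g)) * supN g := by
  rw [Matrix.one_mulVec, Matrix.one_mulVec]
  exact (H.2 (0 : Fin (d + 1)) g xL (Or.inr h)).2

/-- the lattice member «(1.11)–(1.12), derivative» at a lifted instance, on a bond of `Ω̃`.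
[cite: Balaban1983RegularityDecay, (1.11)–(1.12) p.573] -/
theorem lat_dvalDG (R : ℕ)
    (H : Ineq111_112 (regionPairFam F d ℓ amin aplus m2plus creg β K (i.liftInst R)) α δ₀ c₀ R₀)
    (μ : Fin (d + 1)) (g : ↥(fineDom ((ℓ + 1) ^ i.k) (liftLabels i.P R i.ΩT)) × ι → ℝ)
    (xL : ↥(fineDom ((ℓ + 1) ^ i.k) (liftLabels i.P R i.ΩT)))
    (hμ : xL.1 + e1 μ ∈ fineDom ((ℓ + 1) ^ i.k) (liftLabels i.P R i.ΩT)) (h : R₀ ≤ (i.liftInst R).cdist xL) :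
    siteNorm (fld (DL i F R μ *ᵥ ((HL i F R)⁻¹ *ᵥ g)) xL
        - fld (D₀L i F R μ *ᵥ ((H₀L i F R)⁻¹ *ᵥ (i.liftInst R).extR g))
            (incl (Nat.one_le_pow i.k (ℓ + 1) (Nat.succ_pos ℓ)) (i.liftInst R).hsub xL))
      ≤ c₀ * Real.exp (-(δ₀ * (i.liftInst R).sdist1 xL g))
        * Real.exp (-(δ₀ * (i.liftInst R).cdist xL + δ₀ * (i.liftInst R).bdistS g)) * supN g := by
  have key : fld (DL i F R μ *ᵥ ((HL i F R)⁻¹ *ᵥ g)) xL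
        - fld (D₀L i F R μ *ᵥ ((H₀L i F R)⁻¹ *ᵥ (i.liftInst R).extR g))
            (incl (Nat.one_le_pow i.k (ℓ + 1) (Nat.succ_pos ℓ)) (i.liftInst R).hsub xL)
      = fld ((i.liftInst R).DΩ F μ *ᵥ (i.liftInst R).deltaV F g) xL := by
    funext jj
    exact ((i.liftInst R).fld_DΩ_deltaV_apply F μ g xL hμ jj).symm
  rw [key]
  exact (H.2 μ g xL (Or.inr h)).1

/-- **(1.11)–(1.12), VALUE, ON THE TORUS FAMILY**: `|(δG_k(Ω,Ω₀,A)f)(x)| ≤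
c₀e^{−δ₀dist_T(x, supp f)}e^{−δ₀dist_T(x, Ω^c) − δ₀dist_T(supp f, Ω^c)}‖f‖_∞` for `dist_T(x, Ω^c) ≥ R₀` (or `Ω = T_η`).
[cite: Balaban1983RegularityDecay, (1.11)–(1.12) p.573 «operators on subsets of a torus T_η»] -/
theorem dvalG_torus (ha : 0 < amin) (hℓ : 1 ≤ ℓ) (hδ : 0 < δ₀) (hc : 0 < c₀)
    (HI : ∀ R : ℕ, Ineq19_110 (regionPairFam F d ℓ amin aplus m2plus creg β K (i.liftInst R)) α δ₀ c₀ R₀ ∧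
      Ineq111_112 (regionPairFam F d ℓ amin aplus m2plus creg β K (i.liftInst R)) α δ₀ c₀ R₀)
    (HI₀ : ∀ R : ℕ, Ineq19_110 (regionPairFam F d ℓ amin aplus m2plus creg β K (i.liftInst₀ R)) α δ₀ c₀ R₀)
    (f : ↥(fineDom ((ℓ + 1) ^ i.k) i.ΩT) × ι → ℝ) (x : ↥(fineDom ((ℓ + 1) ^ i.k) i.ΩT))
    (hx : fineDom ((ℓ + 1) ^ i.k) i.ΩT = boxDom (per ((ℓ + 1) ^ i.k) i.P) ∨ R₀ ≤ tcdist i.P x) :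
    siteNorm (fld (i.deltaT F f) x) ≤ c₀ * Real.exp (-(δ₀ * tsdist1 i.P x f))
      * Real.exp (-(δ₀ * tcdist i.P x + δ₀ * tbdistS i.P f)) * supN f :=
  member_delta i F ha hℓ hδ hc 1 1 (fun R => 1) (fun R => 1) (fun _ _ => True)
    (fun R u xL _ => by rw [Matrix.one_mulVec, Matrix.one_mulVec, fld_pull])
    (fun R u₀ yL _ => by rw [Matrix.one_mulVec, Matrix.one_mulVec, fld_pull])
    (fun R g xL h => lat_valG i F R (HI R).1 g xL h) (fun R g yL h => lat_valG₀ i F R (HI₀ R) g yL h)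
    (fun R g xL _ h => lat_dvalG i F R (HI R).2 g xL h) f x (fun _ _ => trivial) hx
    (by rw [Matrix.one_mulVec, Matrix.one_mulVec]; rfl)

/-- **(1.11)–(1.12), DERIVATIVE, ON THE TORUS FAMILY**: `|(D^η_{A,μ}δG_k(Ω,Ω₀,A)f)(x)| ≤
c₀e^{−δ₀dist_T(x, supp f)}e^{−δ₀dist_T(x, Ω^c) − δ₀dist_T(supp f, Ω^c)}‖f‖_∞` for `dist_T(x, Ω^c) ≥ R₀` (or `Ω = T_η`).
[cite: Balaban1983RegularityDecay, (1.11)–(1.12) p.573 «operators on subsets of a torus T_η»] -/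
theorem dvalDG_torus (ha : 0 < amin) (hℓ : 1 ≤ ℓ) (hδ : 0 < δ₀) (hc : 0 < c₀)
    (HI : ∀ R : ℕ, Ineq19_110 (regionPairFam F d ℓ amin aplus m2plus creg β K (i.liftInst R)) α δ₀ c₀ R₀ ∧
      Ineq111_112 (regionPairFam F d ℓ amin aplus m2plus creg β K (i.liftInst R)) α δ₀ c₀ R₀)
    (HI₀ : ∀ R : ℕ, Ineq19_110 (regionPairFam F d ℓ amin aplus m2plus creg β K (i.liftInst₀ R)) α δ₀ c₀ R₀)
    (μ : Fin (d + 1)) (f : ↥(fineDom ((ℓ + 1) ^ i.k) i.ΩT) × ι → ℝ) (x : ↥(fineDom ((ℓ + 1) ^ i.k) i.ΩT))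
    (hx : fineDom ((ℓ + 1) ^ i.k) i.ΩT = boxDom (per ((ℓ + 1) ^ i.k) i.P) ∨ R₀ ≤ tcdist i.P x) :
    siteNorm (fld (i.DT F μ *ᵥ i.deltaT F f) x) ≤ c₀ * Real.exp (-(δ₀ * tsdist1 i.P x f))
      * Real.exp (-(δ₀ * tcdist i.P x + δ₀ * tbdistS i.P f)) * supN f := by
  by_cases hxμ : twrap ((ℓ + 1) ^ i.k) i.P (x.1 + e1 μ) ∈ fineDom ((ℓ + 1) ^ i.k) i.ΩT
  · refine member_delta i F ha hℓ hδ hc (i.DT F μ) (i.D₀T F μ) (fun R => DL i F R μ) (fun R => D₀L i F R μ)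
      (fun R xL => xL.1 + e1 μ ∈ fineDom ((ℓ + 1) ^ i.k) (liftLabels i.P R i.ΩT))
      (fun R u xL hint => fld_regionDeriv_pull F (Nat.one_le_pow i.k (ℓ + 1) (Nat.succ_pos ℓ)) i.hP i.h3 i.hboxΩ R i.e i.Ac μ u xL hint)
      (fun R u₀ yL hint => fld_regionDeriv_pull F (Nat.one_le_pow i.k (ℓ + 1) (Nat.succ_pos ℓ)) i.hP i.h3 i.hbox R i.e i.Ac μ u₀ yL hint)
      (fun R g xL h => lat_valDG i F R (HI R).1 μ g xL h) (fun R g yL h => lat_valDG₀ i F R (HI₀ R) μ g yL h)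
      (fun R g xL hs h => lat_dvalDG i F R (HI R).2 μ g xL hs h) f x (fun R hR => ?_) hx
      (i.fld_DT_deltaT F μ f x hxμ)
    exact nbr_mem_lift (Nat.one_le_pow i.k (ℓ + 1) (Nat.succ_pos ℓ)) i.hP i.hboxΩ R ((near_base i R x).isInt (by omega))
      (mem_nbrs.2 ⟨μ, Or.inl rfl⟩) hxμ
  · rw [i.fld_DT_of_not_mem F μ _ x hxμ, siteNorm_zero]
    have := supN_nonneg f
    positivity

omit [Fintype ι] [DecidableEq ι] in
/-- the Hölder weight of a far pair: `y^α ≤ B` for `0 ≤ y ≤ B`, `1 ≤ B`, `0 ≤ α ≤ 1`. [cite: Balaban1983RegularityDecay, (1.9) p.573 «|x − x′|^{−α}», dictionary] -/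
theorem rpow_le_of_le {y B α : ℝ} (hα0 : 0 ≤ α) (hα1 : α ≤ 1) (hy : 0 ≤ y) (hyB : y ≤ B) (hB : 1 ≤ B) :
    y ^ α ≤ B := by
  rcases le_or_gt y 1 with h | h
  · exact (Real.rpow_le_one hy h hα0).trans hB
  · calc y ^ α ≤ y ^ (1 : ℝ) := Real.rpow_le_rpow_of_exponent_le h.le hα1
      _ = y := Real.rpow_one y
      _ ≤ B := hyB

/-- **FAR PAIRS** (`2(d+1)|x′−x|_T ≥ nP_ν` for some `ν`): the weight is at most `2(d+1)` and the transported difference at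
most `|V(x′)| + |V(x)|`. [cite: Balaban1983RegularityDecay, (1.9) p.573, dictionary] -/
theorem holder_far (hα0 : 0 ≤ α) (hα1 : α ≤ 1) {x x' : ↥(fineDom ((ℓ + 1) ^ i.k) i.ΩT)}
    (l : List ↥(fineDom ((ℓ + 1) ^ i.k) i.ΩT))
    (hfar : ¬ ∀ ν, 2 * (((d : ℝ) + 1) * tnorm ((ℓ + 1) ^ i.k) i.P (x'.1 - x.1)) < per ((ℓ + 1) ^ i.k) i.P ν)
    (V : ↥(fineDom ((ℓ + 1) ^ i.k) i.ΩT) × ι → ℝ) {b : ℝ} (hVx : siteNorm (fld V x) ≤ b)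
    (hVx' : siteNorm (fld V x') ≤ b) :
    twt i.P α x x' * siteNorm (transport (fieldLink F i.κ fun a b : ↥(fineDom ((ℓ + 1) ^ i.k) i.ΩT) =>
        torBond ((ℓ + 1) ^ i.k) i.P i.Ac a.1 b.1) x l *ᵥ fld V x' - fld V x) ≤ 4 * ((d : ℝ) + 1) * b := by
  classical
  obtain ⟨ν, hν⟩ := not_forall.1 hfar
  have hν' := not_lt.1 hν
  set T := tnorm ((ℓ + 1) ^ i.k) i.P (x'.1 - x.1) with hT
  have h3 : (3 : ℝ) ≤ per ((ℓ + 1) ^ i.k) i.P ν := by exact_mod_cast i.h3 ν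
  have hd : (0 : ℝ) ≤ d := Nat.cast_nonneg d
  have hTpos : 0 < T := by nlinarith
  have hnn : ((((ℓ + 1) ^ i.k : ℕ) : ℝ)) ≤ per ((ℓ + 1) ^ i.k) i.P ν := by
    have h1 : (ℓ + 1) ^ i.k ≤ per ((ℓ + 1) ^ i.k) i.P ν := Nat.le_mul_of_pos_right _ (i.hP ν)
    exact_mod_cast h1
  have hw : twt i.P α x x' ≤ 2 * ((d : ℝ) + 1) := by
    unfold twt
    refine rpow_le_of_le hα0 hα1 (div_nonneg (Nat.cast_nonneg _) hTpos.le) ?_ (by linarith)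
    rw [div_le_iff₀ hTpos]; linarith
  have hs := siteNorm_transport_sub_le F i.κ (fun a b : ↥(fineDom ((ℓ + 1) ^ i.k) i.ΩT) =>
    torBond ((ℓ + 1) ^ i.k) i.P i.Ac a.1 b.1) x l (fld V x') (fld V x)
  have hw0 : 0 ≤ twt i.P α x x' := by
    unfold twt; exact Real.rpow_nonneg (div_nonneg (Nat.cast_nonneg _) (tnorm_nonneg _ _ _)) _
  calc twt i.P α x x' * siteNorm (transport (fieldLink F i.κ fun a b : ↥(fineDom ((ℓ + 1) ^ i.k) i.ΩT) =>
          torBond ((ℓ + 1) ^ i.k) i.P i.Ac a.1 b.1) x l *ᵥ fld V x' - fld V x)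
      ≤ (2 * ((d : ℝ) + 1)) * (b + b) :=
        mul_le_mul hw (hs.trans (add_le_add hVx' hVx)) (siteNorm_nonneg _) (by positivity)
    _ = 4 * ((d : ℝ) + 1) * b := by ring

/-- **CLOSE PAIRS: THE LIFTED CONTOUR PACKAGE** (`2(d+1)|x′−x|_T < nP_ν` for all `ν`, `|Γ| + 2 ≤ R`): the torus contour
`Γ` from `x` to `x′` lifts to an ADMISSIBLE lattice contour of `Ω̃_R` from the copy-`0` lift `x̃` of `x` to a lift `x̃′`
of `x′` in copies `≤ 1`, with `|x̃′ − x̃|_∞ = |x′ − x|_T` and the same transporter.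
[cite: Balaban1983RegularityDecay, p.573 «Γ_{x,x′} denotes a shortest contour», p.572 «periodic conditions»] -/
theorem chain_pack (R : ℕ) {μ : Fin (d + 1)} {x x' : ↥(fineDom ((ℓ + 1) ^ i.k) i.ΩT)}
    {l : List ↥(fineDom ((ℓ + 1) ^ i.k) i.ΩT)} (hl : TAdm i.P μ x x' l)
    (hclose : ∀ ν, 2 * (((d : ℝ) + 1) * tnorm ((ℓ + 1) ^ i.k) i.P (x'.1 - x.1)) < per ((ℓ + 1) ^ i.k) i.P ν)
    (hR : l.length + 2 ≤ R) :
    ∃ (xL' : ↥(fineDom ((ℓ + 1) ^ i.k) (liftLabels i.P R i.ΩT)))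
      (lL : List ↥(fineDom ((ℓ + 1) ^ i.k) (liftLabels i.P R i.ΩT))),
      (i.liftInst R).Adm μ (base i R x) xL' lL ∧ proj (Nat.one_le_pow i.k (ℓ + 1) (Nat.succ_pos ℓ)) i.hP i.hboxΩ R xL' = x' ∧
      Near ((ℓ + 1) ^ i.k) i.P 1 xL'.1 ∧
      supNorm (xL'.1 - (base i R x).1) = tnorm ((ℓ + 1) ^ i.k) i.P (x'.1 - x.1) ∧
      transport (fieldLink F i.κ fun a b : ↥(fineDom ((ℓ + 1) ^ i.k) (liftLabels i.P R i.ΩT)) =>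
          compField (perField ((ℓ + 1) ^ i.k) i.P i.Ac) a.1 b.1) (base i R x) lL
        = transport (fieldLink F i.κ fun a b : ↥(fineDom ((ℓ + 1) ^ i.k) i.ΩT) =>
          torBond ((ℓ + 1) ^ i.k) i.P i.Ac a.1 b.1) x l := by
  obtain ⟨hbx, hbx', hne, hpath, hend, hlen, hball⟩ := hl
  set xL := base i R x with hxL
  set T := tnorm ((ℓ + 1) ^ i.k) i.P (x'.1 - x.1) with hT
  have hnear0 : Near ((ℓ + 1) ^ i.k) i.P 0 xL.1 := near_base i R x
  have hint0 : IsInt ((ℓ + 1) ^ i.k) i.P R xL.1 := hnear0.isInt (by omega)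
  have hproj : proj (Nat.one_le_pow i.k (ℓ + 1) (Nat.succ_pos ℓ)) i.hP i.hboxΩ R xL = x := proj_base i R x
  have hpath' : PathRel (fun u v : ↥(fineDom ((ℓ + 1) ^ i.k) i.ΩT) => TNbr ((ℓ + 1) ^ i.k) i.P u.1 v.1)
      (proj (Nat.one_le_pow i.k (ℓ + 1) (Nat.succ_pos ℓ)) i.hP i.hboxΩ R xL) l := by rw [hproj]; exact hpath
  obtain ⟨hchain, hmap, hend', hnearL, htrans⟩ :=
    liftChain_spec F (Nat.one_le_pow i.k (ℓ + 1) (Nat.succ_pos ℓ)) i.hP i.h3 i.hboxΩ R i.κ i.Ac l xL 0 hnear0 (by omega) hpath'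
  set lL := liftChain (Nat.one_le_pow i.k (ℓ + 1) (Nat.succ_pos ℓ)) i.hP i.hboxΩ R xL l with hlL
  set xL' := pathEnd xL lL with hxL'
  have hproj' : proj (Nat.one_le_pow i.k (ℓ + 1) (Nat.succ_pos ℓ)) i.hP i.hboxΩ R xL' = x' := by rw [hxL', hend', hproj, hend]
  have htw0 : twrap ((ℓ + 1) ^ i.k) i.P xL.1 = x.1 := congrArg Subtype.val hproj
  have htw' : twrap ((ℓ + 1) ^ i.k) i.P xL'.1 = x'.1 := congrArg Subtype.val hproj'
  -- short vectors
  have hsmall : ∀ v : Fin (d + 1) → ℤ, supNorm v ≤ (l.length : ℝ) → ∀ ν, 2 * |v ν| < per ((ℓ + 1) ^ i.k) i.P ν := by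
    intro v hv ν
    have h1 : ((|v ν| : ℤ) : ℝ) ≤ supNorm v := abs_le_supNorm v ν
    have h2 := hclose ν
    have h3 : (2 : ℝ) * ((|v ν| : ℤ) : ℝ) < per ((ℓ + 1) ^ i.k) i.P ν := by linarith
    exact_mod_cast h3
  have hsupL' : supNorm (xL'.1 - xL.1) ≤ l.length := by
    rcases pathEnd_eq_or_mem xL lL with h | h
    · rw [← hxL'] at h
      rw [h, sub_self]
      exact supNorm_le_of_forall fun ν => by simp
    · rw [← hxL'] at h
      simpa only [Nat.cast_zero, zero_add] using (hnearL xL' h).2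
  have hdist : supNorm (xL'.1 - xL.1) = T := by
    rw [← tnorm_eq_supNorm_of_small (hsmall _ hsupL'), ← tnorm_twrap_sub_twrap, htw0, htw']
  have hnear1' : Near ((ℓ + 1) ^ i.k) i.P 1 xL'.1 := by
    have hb : xL.1 ∈ boxDom (per ((ℓ + 1) ^ i.k) i.P) := val_mem_perBox (Nat.one_le_pow i.k (ℓ + 1) (Nat.succ_pos ℓ)) i.hboxΩ x
    have h := abs_cidx_blk_le_one (Nat.one_le_pow i.k (ℓ + 1) (Nat.succ_pos ℓ)) i.hP hb (z := xL'.1) fun ν => by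
      have := hsmall _ hsupL' ν
      have h0 : 0 ≤ |(xL'.1 - xL.1) ν| := abs_nonneg _
      rw [Pi.sub_apply] at this h0
      omega
    intro ν; exact_mod_cast h ν
  have hint' : IsInt ((ℓ + 1) ^ i.k) i.P R xL'.1 := hnear1'.isInt (by omega)
  refine ⟨xL', lL, ?_, hproj', hnear1', hdist, by rw [hproj] at htrans; exact htrans⟩
  unfold RegionPairInst.Adm
  refine ⟨?_, ?_, ?_, hchain, rfl, ?_, ?_⟩
  · exact nbr_mem_lift (Nat.one_le_pow i.k (ℓ + 1) (Nat.succ_pos ℓ)) i.hP i.hboxΩ R hint0 (mem_nbrs.2 ⟨μ, Or.inl rfl⟩) hbx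
  · exact nbr_mem_lift (Nat.one_le_pow i.k (ℓ + 1) (Nat.succ_pos ℓ)) i.hP i.hboxΩ R hint' (mem_nbrs.2 ⟨μ, Or.inl rfl⟩)
      (by rw [← twrap_twrap_add, htw']; exact hbx')
  · intro h
    apply hne
    have := congrArg (twrap ((ℓ + 1) ^ i.k) i.P) h
    rwa [htw', htw0] at this
  · show ((liftChain (Nat.one_le_pow i.k (ℓ + 1) (Nat.succ_pos ℓ)) i.hP i.hboxΩ R xL l).length : ℝ) ≤ ((d : ℝ) + 1) * supNorm (xL'.1 - xL.1)
    rw [liftChain_length, hdist]; exact hlen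
  · intro z hz
    obtain ⟨-, hzsup⟩ := hnearL z hz
    show supNorm (z.1 - xL.1) ≤ supNorm (xL'.1 - xL.1)
    rw [hdist, ← tnorm_eq_supNorm_of_small (hsmall _ hzsup), ← tnorm_twrap_sub_twrap, htw0]
    have hzl : proj (Nat.one_le_pow i.k (ℓ + 1) (Nat.succ_pos ℓ)) i.hP i.hboxΩ R z ∈ l := by rw [← hmap]; exact List.mem_map_of_mem hz
    have hbz := hball (proj (Nat.one_le_pow i.k (ℓ + 1) (Nat.succ_pos ℓ)) i.hP i.hboxΩ R z) hzl
    rw [proj_val] at hbz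
    exact hbz

/-- **(1.9) ON THE TORUS FAMILY**: `|x−x′|_T^{−α}|U(A(Γ_{x,x′}))(D^η_{A,μ}G_k(Ω,A)f)(x′) − (D^η_{A,μ}G_k(Ω,A)f)(x)| ≤
4(d+1)c₀e^{−δ₀dist_T({x,x′}, supp f)}‖f‖_∞` for `dist_T({x,x′}, Ω^c) ≥ R₀` (or `Ω = T_η`), every admissible torus contour.
[cite: Balaban1983RegularityDecay, (1.9) p.573 «operators on subsets of a torus T_η»] -/
theorem lhs19_torus (ha : 0 < amin) (hℓ : 1 ≤ ℓ) (hδ : 0 < δ₀) (hc : 0 < c₀) (hα0 : 0 ≤ α) (hα1 : α ≤ 1)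
    (HI : ∀ R : ℕ, Ineq19_110 (regionPairFam F d ℓ amin aplus m2plus creg β K (i.liftInst R)) α δ₀ c₀ R₀)
    (μ : Fin (d + 1)) (f : ↥(fineDom ((ℓ + 1) ^ i.k) i.ΩT) × ι → ℝ) (x x' : ↥(fineDom ((ℓ + 1) ^ i.k) i.ΩT))
    (hx : fineDom ((ℓ + 1) ^ i.k) i.ΩT = boxDom (per ((ℓ + 1) ^ i.k) i.P) ∨
      R₀ ≤ min (tcdist i.P x) (tcdist i.P x')) :
    tholderQ i.P F i.κ i.Ac α μ (i.DT F μ *ᵥ (i.GT F *ᵥ f)) x x'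
      ≤ 4 * ((d : ℝ) + 1) * c₀ * Real.exp (-(δ₀ * min (tsdist1 i.P x f) (tsdist1 i.P x' f))) * supN f := by
  set m := min (tsdist1 i.P x f) (tsdist1 i.P x' f) with hm
  set V := i.DT F μ *ᵥ (i.GT F *ᵥ f) with hV
  have hxc : fineDom ((ℓ + 1) ^ i.k) i.ΩT = boxDom (per ((ℓ + 1) ^ i.k) i.P) ∨ R₀ ≤ tcdist i.P x :=
    hx.imp id fun h => h.trans (min_le_left _ _)
  have hxc' : fineDom ((ℓ + 1) ^ i.k) i.ΩT = boxDom (per ((ℓ + 1) ^ i.k) i.P) ∨ R₀ ≤ tcdist i.P x' :=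
    hx.imp id fun h => h.trans (min_le_right _ _)
  have hsf := supN_nonneg f
  have hb0 : 0 ≤ c₀ * Real.exp (-(δ₀ * m)) * supN f := by positivity
  have hd : (0 : ℝ) ≤ d := Nat.cast_nonneg d
  refine tholderQ_le i.P F i.κ i.Ac (by positivity) fun l hl => ?_
  by_cases hclose : ∀ ν, 2 * (((d : ℝ) + 1) * tnorm ((ℓ + 1) ^ i.k) i.P (x'.1 - x.1)) < per ((ℓ + 1) ^ i.k) i.P ν
  swap
  · -- far pairs
    have hVx : siteNorm (fld V x) ≤ c₀ * Real.exp (-(δ₀ * m)) * supN f :=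
      (valDG_torus i F ha hℓ hδ hc HI μ f x hxc).trans (decay_mono hc.le hδ.le (min_le_left _ _) le_rfl hsf)
    have hVx' : siteNorm (fld V x') ≤ c₀ * Real.exp (-(δ₀ * m)) * supN f :=
      (valDG_torus i F ha hℓ hδ hc HI μ f x' hxc').trans (decay_mono hc.le hδ.le (min_le_right _ _) le_rfl hsf)
    exact (holder_far i F hα0 hα1 l hclose V hVx hVx').trans (le_of_eq (by ring))
  -- close pairs: lifting
  set u := i.GT F *ᵥ f with hu
  set W := twt i.P α x x' with hW
  have hW0 : 0 ≤ W := Real.rpow_nonneg (div_nonneg (Nat.cast_nonneg _) (tnorm_nonneg _ _ _)) _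
  suffices hsuff : W * siteNorm (transport (fieldLink F i.κ fun a b : ↥(fineDom ((ℓ + 1) ^ i.k) i.ΩT) =>
      torBond ((ℓ + 1) ^ i.k) i.P i.Ac a.1 b.1) x l *ᵥ fld V x' - fld V x) ≤ c₀ * Real.exp (-(δ₀ * m)) * supN f by
    refine hsuff.trans ?_
    have h1 : (1 : ℝ) ≤ 4 * ((d : ℝ) + 1) := by linarith
    calc c₀ * Real.exp (-(δ₀ * m)) * supN f = 1 * (c₀ * Real.exp (-(δ₀ * m)) * supN f) := by ring
      _ ≤ (4 * ((d : ℝ) + 1)) * (c₀ * Real.exp (-(δ₀ * m)) * supN f) := mul_le_mul_of_nonneg_right h1 hb0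
      _ = _ := by ring
  refine le_of_forall_exp_tail hδ (max (max R₀ 0) (l.length : ℝ))
    (c := W * (2 * (c₀ * Real.exp δ₀ * (CH i * supN u)))) fun S hS => ?_
  have hSR₀ : R₀ ≤ S := ((le_max_left _ _).trans (le_max_left _ _)).trans hS
  have hSl : (l.length : ℝ) ≤ S := (le_max_right _ _).trans hS
  have hSl' : l.length ≤ S := by exact_mod_cast hSl
  set R : ℕ := 2 * S + 2 with hR
  have hSR : S + 1 ≤ R := by omega
  have hRS : (R : ℝ) = 2 * S + 2 := by rw [hR]; push_cast; ring
  obtain ⟨xL', lL, hAdm, hproj', hnear1', hdist, htrans⟩ := chain_pack i F R hl hclose (by omega)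
  set xL := base i R x with hxL
  have hnear0 : Near ((ℓ + 1) ^ i.k) i.P 0 xL.1 := near_base i R x
  have hint0 : IsInt ((ℓ + 1) ^ i.k) i.P R xL.1 := hnear0.isInt (by omega)
  have hproj : proj (Nat.one_le_pow i.k (ℓ + 1) (Nat.succ_pos ℓ)) i.hP i.hboxΩ R xL = x := proj_base i R x
  have hint' : IsInt ((ℓ + 1) ^ i.k) i.P R xL'.1 := hnear1'.isInt (by omega)
  have hcd : R₀ ≤ (i.liftInst R).cdist xL :=
    le_cdist_lift i R xL hnear0 (hxc.imp id fun h => by rw [hproj]; exact h)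
      (by simp only [Nat.cast_zero, sub_zero]; linarith)
  have hcd' : R₀ ≤ (i.liftInst R).cdist xL' :=
    le_cdist_lift i R xL' hnear1' (hxc'.imp id fun h => by rw [hproj']; exact h)
      (by simp only [Nat.cast_one]; linarith)
  have hcd2 : R₀ ≤ min ((i.liftInst R).cdist xL) ((i.liftInst R).cdist xL') := le_min hcd hcd'
  -- sources
  set w := HL i F R *ᵥ pull (Nat.one_le_pow i.k (ℓ + 1) (Nat.succ_pos ℓ)) i.hP i.hboxΩ R u with hw
  set wN := cutNear ((ℓ + 1) ^ i.k) i.P S w with hwN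
  have hwN' : wN = cutNear ((ℓ + 1) ^ i.k) i.P S (pull (Nat.one_le_pow i.k (ℓ + 1) (Nat.succ_pos ℓ)) i.hP i.hboxΩ R f) := by
    rw [hwN, hw, hu]; exact cutNear_HL_pull i F ha hℓ hSR f
  have hpull : pull (Nat.one_le_pow i.k (ℓ + 1) (Nat.succ_pos ℓ)) i.hP i.hboxΩ R u = (HL i F R)⁻¹ *ᵥ wN + (HL i F R)⁻¹ *ᵥ (w - wN) := by
    rw [← Matrix.mulVec_add, add_sub_cancel, hw]
    exact pull_eq i F ha hℓ R u
  -- the lattice fields and the split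
  set VL : (↥(fineDom ((ℓ + 1) ^ i.k) (liftLabels i.P R i.ΩT)) × ι → ℝ) →
      (↥(fineDom ((ℓ + 1) ^ i.k) (liftLabels i.P R i.ΩT)) × ι → ℝ) :=
    fun g => DL i F R μ *ᵥ ((HL i F R)⁻¹ *ᵥ g) with hVL
  have hVat : ∀ z : ↥(fineDom ((ℓ + 1) ^ i.k) (liftLabels i.P R i.ΩT)), IsInt ((ℓ + 1) ^ i.k) i.P R z.1 →
      fld V (proj (Nat.one_le_pow i.k (ℓ + 1) (Nat.succ_pos ℓ)) i.hP i.hboxΩ R z) = fld (VL wN) z + fld (VL (w - wN)) z := by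
    intro z hz
    rw [hV, ← fld_regionDeriv_pull F (Nat.one_le_pow i.k (ℓ + 1) (Nat.succ_pos ℓ)) i.hP i.h3 i.hboxΩ R i.e i.Ac μ u z hz, hpull, Matrix.mulVec_add]
    rfl
  have hVx : fld V x = fld (VL wN) xL + fld (VL (w - wN)) xL := by
    have h := hVat xL hint0; rwa [hproj] at h
  have hVx' : fld V x' = fld (VL wN) xL' + fld (VL (w - wN)) xL' := by
    have h := hVat xL' hint'; rwa [hproj'] at h
  set U := transport (fieldLink F i.κ fun a b : ↥(fineDom ((ℓ + 1) ^ i.k) (liftLabels i.P R i.ΩT)) =>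
    compField (perField ((ℓ + 1) ^ i.k) i.P i.Ac) a.1 b.1) xL lL with hU
  have hsplit : transport (fieldLink F i.κ fun a b : ↥(fineDom ((ℓ + 1) ^ i.k) i.ΩT) =>
        torBond ((ℓ + 1) ^ i.k) i.P i.Ac a.1 b.1) x l *ᵥ fld V x' - fld V x
      = (U *ᵥ fld (VL wN) xL' - fld (VL wN) xL) + (U *ᵥ fld (VL (w - wN)) xL' - fld (VL (w - wN)) xL) := by
    rw [← htrans, hVx, hVx', Matrix.mulVec_add]; abel
  -- the weights agree
  have hWL : (i.liftInst R).wt α xL xL' = W := by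
    show ((((ℓ + 1) ^ i.k : ℕ) : ℝ) / supNorm (xL'.1 - xL.1)) ^ α = W
    rw [hdist]
    rfl
  -- the lattice (1.9) for every source
  have hlat : ∀ g, W * siteNorm (U *ᵥ fld (VL g) xL' - fld (VL g) xL)
      ≤ c₀ * Real.exp (-(δ₀ * min ((i.liftInst R).sdist1 xL g) ((i.liftInst R).sdist1 xL' g))) * supN g := by
    intro g
    have h1 := le_holderQ (i.liftInst R) F (α := α) (VL g) hAdm
    rw [hWL] at h1
    exact h1.trans ((HI R).1 μ g xL xL' (Or.inr hcd2))
  -- the near piece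
  have hmain : W * siteNorm (U *ᵥ fld (VL wN) xL' - fld (VL wN) xL) ≤ c₀ * Real.exp (-(δ₀ * m)) * supN f := by
    by_cases hne : ((i.liftInst R).supp wN).Nonempty
    · refine (hlat wN).trans (decay_mono hc.le hδ.le (le_min ?_ ?_) ?_ (supN_nonneg _))
      · refine (min_le_left _ _).trans (lat_le_sdist1 (i.liftInst R) xL wN hne fun z hz => ?_)
        rw [hwN'] at hz
        have := tsdist1_le_of_supp_cutNear i R S f xL z hz
        rwa [hproj] at this
      · refine (min_le_right _ _).trans (lat_le_sdist1 (i.liftInst R) xL' wN hne fun z hz => ?_)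
        rw [hwN'] at hz
        have := tsdist1_le_of_supp_cutNear i R S f xL' z hz
        rwa [hproj'] at this
      · rw [hwN']; exact (supN_cutNear_le _).trans (supN_pull_le (Nat.one_le_pow i.k (ℓ + 1) (Nat.succ_pos ℓ)) i.hP i.hboxΩ R f)
    · have h0 : wN = 0 := funext fun p => congrFun (lat_eq_zero_of_supp (i.liftInst R) hne) p
      have h1 : U *ᵥ fld (VL wN) xL' - fld (VL wN) xL = 0 := by
        rw [h0]; simp only [hVL, Matrix.mulVec_zero, fld_zero, sub_self]
      rw [h1, siteNorm_zero, mul_zero]; exact hb0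
  -- the far piece
  have hB : supN (w - wN) ≤ CH i * supN u :=
    calc supN (w - wN) ≤ supN w := supN_sub_cutNear_le _
      _ ≤ CH i * supN (pull (Nat.one_le_pow i.k (ℓ + 1) (Nat.succ_pos ℓ)) i.hP i.hboxΩ R u) := supN_HL_le i F ha hℓ R _
      _ ≤ CH i * supN u := mul_le_mul_of_nonneg_left (supN_pull_le _ _ _ R u) (CH_nonneg i ha hℓ)
  have htail_pt : ∀ z : ↥(fineDom ((ℓ + 1) ^ i.k) (liftLabels i.P R i.ΩT)), Near ((ℓ + 1) ^ i.k) i.P 1 z.1 →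
      R₀ ≤ (i.liftInst R).cdist z →
      siteNorm (fld (VL (w - wN)) z) ≤ c₀ * Real.exp (-(δ₀ * ((S : ℝ) - 1))) * (CH i * supN u) := by
    intro z hz hzc
    refine lat_decay_transfer (i.liftInst R) z (w - wN) hc.le hδ.le hB (lat_valDG i F R (HI R) μ (w - wN) z hzc) ?_ ?_
    · intro h
      have h0 : w - wN = 0 := funext h
      simp only [hVL]; rw [h0, Matrix.mulVec_zero, Matrix.mulVec_zero]; rfl
    · intro z' hz'
      have := far_le_of_supp_sub_cutNear i (i.liftInst R) S 1 w z z' hz hz'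
      simpa using this
  have hexp : Real.exp (-(δ₀ * ((S : ℝ) - 1))) = Real.exp δ₀ * Real.exp (-(δ₀ * S)) := by
    rw [← Real.exp_add]; congr 1; ring
  have ht := htail_pt xL (hnear0.mono (by norm_num)) hcd
  have ht' := htail_pt xL' hnear1' hcd'
  rw [hexp] at ht ht'
  have htail : W * siteNorm (U *ᵥ fld (VL (w - wN)) xL' - fld (VL (w - wN)) xL)
      ≤ W * (2 * (c₀ * Real.exp δ₀ * (CH i * supN u))) * Real.exp (-(δ₀ * S)) := by
    have h1 := siteNorm_transport_sub_le F i.κ (fun a b : ↥(fineDom ((ℓ + 1) ^ i.k) (liftLabels i.P R i.ΩT)) =>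
      compField (perField ((ℓ + 1) ^ i.k) i.P i.Ac) a.1 b.1) xL lL (fld (VL (w - wN)) xL') (fld (VL (w - wN)) xL)
    calc W * siteNorm (U *ᵥ fld (VL (w - wN)) xL' - fld (VL (w - wN)) xL)
        ≤ W * (siteNorm (fld (VL (w - wN)) xL') + siteNorm (fld (VL (w - wN)) xL)) :=
          mul_le_mul_of_nonneg_left h1 hW0
      _ ≤ W * (c₀ * (Real.exp δ₀ * Real.exp (-(δ₀ * S))) * (CH i * supN u)
            + c₀ * (Real.exp δ₀ * Real.exp (-(δ₀ * S))) * (CH i * supN u)) :=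
          mul_le_mul_of_nonneg_left (add_le_add ht' ht) hW0
      _ = W * (2 * (c₀ * Real.exp δ₀ * (CH i * supN u))) * Real.exp (-(δ₀ * S)) := by ring
  rw [hsplit]
  calc W * siteNorm (_ + _) ≤ W * (siteNorm _ + siteNorm _) := mul_le_mul_of_nonneg_left (siteNorm_add_le _ _) hW0
    _ = W * siteNorm _ + W * siteNorm _ := mul_add _ _ _
    _ ≤ _ := add_le_add hmain htail

set_option maxHeartbeats 400000 in
/-- **(1.11)–(1.12), HÖLDER, ON THE TORUS FAMILY**: the quotient (1.9) of `D^η_{A,μ}δG_k(Ω,Ω₀,A)f` is bounded by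
`4(d+1)c₀e^{−δ₀dist_T({x,x′}, supp f)}e^{−δ₀dist_T({x,x′}, Ω^c) − δ₀dist_T(supp f, Ω^c)}‖f‖_∞` for
`dist_T({x,x′}, Ω^c) ≥ R₀` (or `Ω = T_η`). [cite: Balaban1983RegularityDecay, (1.11)–(1.12) p.573 «operators on subsets of a torus T_η»] -/
theorem dlhs19_torus (ha : 0 < amin) (hℓ : 1 ≤ ℓ) (hδ : 0 < δ₀) (hc : 0 < c₀) (hα0 : 0 ≤ α) (hα1 : α ≤ 1)
    (HI : ∀ R : ℕ, Ineq19_110 (regionPairFam F d ℓ amin aplus m2plus creg β K (i.liftInst R)) α δ₀ c₀ R₀ ∧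
      Ineq111_112 (regionPairFam F d ℓ amin aplus m2plus creg β K (i.liftInst R)) α δ₀ c₀ R₀)
    (HI₀ : ∀ R : ℕ, Ineq19_110 (regionPairFam F d ℓ amin aplus m2plus creg β K (i.liftInst₀ R)) α δ₀ c₀ R₀)
    (μ : Fin (d + 1)) (f : ↥(fineDom ((ℓ + 1) ^ i.k) i.ΩT) × ι → ℝ) (x x' : ↥(fineDom ((ℓ + 1) ^ i.k) i.ΩT))
    (hx : fineDom ((ℓ + 1) ^ i.k) i.ΩT = boxDom (per ((ℓ + 1) ^ i.k) i.P) ∨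
      R₀ ≤ min (tcdist i.P x) (tcdist i.P x')) :
    tholderQ i.P F i.κ i.Ac α μ (i.DT F μ *ᵥ i.deltaT F f) x x'
      ≤ 4 * ((d : ℝ) + 1) * c₀ * Real.exp (-(δ₀ * min (tsdist1 i.P x f) (tsdist1 i.P x' f)))
        * Real.exp (-(δ₀ * min (tcdist i.P x) (tcdist i.P x') + δ₀ * tbdistS i.P f)) * supN f := by
  set m := min (tsdist1 i.P x f) (tsdist1 i.P x' f) with hm
  set mb := min (tcdist i.P x) (tcdist i.P x') with hmb
  set E := tbdistS i.P f with hE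
  set V := i.DT F μ *ᵥ i.deltaT F f with hV
  have hxc : fineDom ((ℓ + 1) ^ i.k) i.ΩT = boxDom (per ((ℓ + 1) ^ i.k) i.P) ∨ R₀ ≤ tcdist i.P x :=
    hx.imp id fun h => h.trans (min_le_left _ _)
  have hxc' : fineDom ((ℓ + 1) ^ i.k) i.ΩT = boxDom (per ((ℓ + 1) ^ i.k) i.P) ∨ R₀ ≤ tcdist i.P x' :=
    hx.imp id fun h => h.trans (min_le_right _ _)
  have hsf := supN_nonneg f
  have hb0 : 0 ≤ c₀ * Real.exp (-(δ₀ * m)) * Real.exp (-(δ₀ * mb + δ₀ * E)) * supN f := by positivity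
  have hd : (0 : ℝ) ≤ d := Nat.cast_nonneg d
  refine tholderQ_le i.P F i.κ i.Ac (by positivity) fun l hl => ?_
  by_cases hclose : ∀ ν, 2 * (((d : ℝ) + 1) * tnorm ((ℓ + 1) ^ i.k) i.P (x'.1 - x.1)) < per ((ℓ + 1) ^ i.k) i.P ν
  swap
  · -- far pairs
    have hVx : siteNorm (fld V x) ≤ c₀ * Real.exp (-(δ₀ * m)) * Real.exp (-(δ₀ * mb + δ₀ * E)) * supN f :=
      (dvalDG_torus i F ha hℓ hδ hc HI HI₀ μ f x hxc).trans
        (decay_mono₂ hc.le hδ.le (min_le_left _ _) (min_le_left _ _) le_rfl le_rfl hsf)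
    have hVx' : siteNorm (fld V x') ≤ c₀ * Real.exp (-(δ₀ * m)) * Real.exp (-(δ₀ * mb + δ₀ * E)) * supN f :=
      (dvalDG_torus i F ha hℓ hδ hc HI HI₀ μ f x' hxc').trans
        (decay_mono₂ hc.le hδ.le (min_le_right _ _) (min_le_right _ _) le_rfl le_rfl hsf)
    exact (holder_far i F hα0 hα1 l hclose V hVx hVx').trans (le_of_eq (by ring))
  -- close pairs: lifting
  have hbx := hl.1
  have hbx' := hl.2.1
  set u := i.GT F *ᵥ f with hu
  set u₀ := i.G₀T F *ᵥ i.extT f with hu₀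
  set W := twt i.P α x x' with hW
  have hW0 : 0 ≤ W := Real.rpow_nonneg (div_nonneg (Nat.cast_nonneg _) (tnorm_nonneg _ _ _)) _
  suffices hsuff : W * siteNorm (transport (fieldLink F i.κ fun a b : ↥(fineDom ((ℓ + 1) ^ i.k) i.ΩT) =>
      torBond ((ℓ + 1) ^ i.k) i.P i.Ac a.1 b.1) x l *ᵥ fld V x' - fld V x)
      ≤ c₀ * Real.exp (-(δ₀ * m)) * Real.exp (-(δ₀ * mb + δ₀ * E)) * supN f by
    refine hsuff.trans ?_
    have h1 : (1 : ℝ) ≤ 4 * ((d : ℝ) + 1) := by linarith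
    calc c₀ * Real.exp (-(δ₀ * m)) * Real.exp (-(δ₀ * mb + δ₀ * E)) * supN f
        = 1 * (c₀ * Real.exp (-(δ₀ * m)) * Real.exp (-(δ₀ * mb + δ₀ * E)) * supN f) := by ring
      _ ≤ (4 * ((d : ℝ) + 1)) * (c₀ * Real.exp (-(δ₀ * m)) * Real.exp (-(δ₀ * mb + δ₀ * E)) * supN f) :=
          mul_le_mul_of_nonneg_right h1 hb0
      _ = _ := by ring
  refine le_of_forall_exp_tail hδ
    (max (max (max R₀ 0) (l.length : ℝ)) (max (max (tcdist i.P x) (tcdist i.P x')) (tbdistS i.P f)))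
    (c := W * (2 * (c₀ * Real.exp δ₀ * (CH i * supN u + CH i * supN u₀)))) fun S hS => ?_
  have hSR₀ : R₀ ≤ S := (((le_max_left _ _).trans (le_max_left _ _)).trans (le_max_left _ _)).trans hS
  have hSl : (l.length : ℝ) ≤ S := ((le_max_right _ _).trans (le_max_left _ _)).trans hS
  have hSc : tcdist i.P x ≤ S := (((le_max_left _ _).trans (le_max_left _ _)).trans (le_max_right _ _)).trans hS
  have hSc' : tcdist i.P x' ≤ S :=
    (((le_max_right _ _).trans (le_max_left _ _)).trans (le_max_right _ _)).trans hS
  have hSb : tbdistS i.P f ≤ S := ((le_max_right _ _).trans (le_max_right _ _)).trans hS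
  have hSl' : l.length ≤ S := by exact_mod_cast hSl
  set R : ℕ := 2 * S + 2 with hR
  have hSR : S + 1 ≤ R := by omega
  have hRS : (R : ℝ) = 2 * S + 2 := by rw [hR]; push_cast; ring
  obtain ⟨xL', lL, hAdm, hproj', hnear1', hdist, htrans⟩ := chain_pack i F R hl hclose (by omega)
  set xL := base i R x with hxL
  have hnear0 : Near ((ℓ + 1) ^ i.k) i.P 0 xL.1 := near_base i R x
  have hint0 : IsInt ((ℓ + 1) ^ i.k) i.P R xL.1 := hnear0.isInt (by omega)
  have hproj : proj (Nat.one_le_pow i.k (ℓ + 1) (Nat.succ_pos ℓ)) i.hP i.hboxΩ R xL = x := proj_base i R x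
  have hint' : IsInt ((ℓ + 1) ^ i.k) i.P R xL'.1 := hnear1'.isInt (by omega)
  have htw' : twrap ((ℓ + 1) ^ i.k) i.P xL'.1 = x'.1 := congrArg Subtype.val hproj'
  obtain ⟨hbL, hbL', -, -, -, -, -⟩ := id hAdm
  -- the sites over `x`, `x′` in the lift of `Ω₀`
  set yL : ↥(fineDom ((ℓ + 1) ^ i.k) (liftLabels i.P R i.Ω₀T)) :=
    incl (Nat.one_le_pow i.k (ℓ + 1) (Nat.succ_pos ℓ)) (i.liftInst R).hsub xL with hyL
  set yL' : ↥(fineDom ((ℓ + 1) ^ i.k) (liftLabels i.P R i.Ω₀T)) :=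
    incl (Nat.one_le_pow i.k (ℓ + 1) (Nat.succ_pos ℓ)) (i.liftInst R).hsub xL' with hyL'
  have hnear0y : Near ((ℓ + 1) ^ i.k) i.P 1 yL.1 := hnear0.mono (by norm_num)
  have hnear1y : Near ((ℓ + 1) ^ i.k) i.P 1 yL'.1 := hnear1'
  have hinty : IsInt ((ℓ + 1) ^ i.k) i.P R yL.1 := hint0
  have hinty' : IsInt ((ℓ + 1) ^ i.k) i.P R yL'.1 := hint'
  -- distances to the complements
  have hcd : R₀ ≤ (i.liftInst R).cdist xL :=
    le_cdist_lift i R xL hnear0 (hxc.imp id fun h => by rw [hproj]; exact h)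
      (by simp only [Nat.cast_zero, sub_zero]; linarith)
  have hcd' : R₀ ≤ (i.liftInst R).cdist xL' :=
    le_cdist_lift i R xL' hnear1' (hxc'.imp id fun h => by rw [hproj']; exact h)
      (by simp only [Nat.cast_one]; linarith)
  have hcd2 : R₀ ≤ min ((i.liftInst R).cdist xL) ((i.liftInst R).cdist xL') := le_min hcd hcd'
  have hcdx : tcdist i.P x ≤ (i.liftInst R).cdist xL :=
    le_cdist_lift i R xL hnear0 (Or.inr (by rw [hproj])) (by simp only [Nat.cast_zero, sub_zero]; linarith)
  have hcdx' : tcdist i.P x' ≤ (i.liftInst R).cdist xL' :=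
    le_cdist_lift i R xL' hnear1' (Or.inr (by rw [hproj'])) (by simp only [Nat.cast_one]; linarith)
  have hmb : mb ≤ min ((i.liftInst R).cdist xL) ((i.liftInst R).cdist xL') :=
    le_min ((min_le_left _ _).trans hcdx) ((min_le_right _ _).trans hcdx')
  have hxrep : x.1 = twrap ((ℓ + 1) ^ i.k) i.P yL.1 := (twrap_eq_self (val_mem_perBox (Nat.one_le_pow i.k (ℓ + 1) (Nat.succ_pos ℓ)) i.hboxΩ x)).symm
  have hcd₀ : R₀ ≤ (i.liftInst₀ R).cdist yL :=
    le_cdist_lift₀ i R yL hnear0y (hxc.imp id fun h => ⟨x, hxrep, h⟩) (by simp only [Nat.cast_one]; linarith)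
  have hcd₀' : R₀ ≤ (i.liftInst₀ R).cdist yL' :=
    le_cdist_lift₀ i R yL' hnear1y (hxc'.imp id fun h => ⟨x', htw'.symm, h⟩) (by simp only [Nat.cast_one]; linarith)
  -- sources
  set w := HL i F R *ᵥ pull (Nat.one_le_pow i.k (ℓ + 1) (Nat.succ_pos ℓ)) i.hP i.hboxΩ R u with hw
  set wN := cutNear ((ℓ + 1) ^ i.k) i.P S w with hwN
  set g := cutNear ((ℓ + 1) ^ i.k) i.P S (Ω' := liftLabels i.P R i.ΩT) (pull (Nat.one_le_pow i.k (ℓ + 1) (Nat.succ_pos ℓ)) i.hP i.hboxΩ R f) with hg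
  have hwN' : wN = g := by rw [hwN, hw, hu, hg]; exact cutNear_HL_pull i F ha hℓ hSR f
  set w₀ := H₀L i F R *ᵥ pull (Nat.one_le_pow i.k (ℓ + 1) (Nat.succ_pos ℓ)) i.hP i.hbox R u₀ with hw₀
  set w₀N := cutNear ((ℓ + 1) ^ i.k) i.P S w₀ with hw₀N
  have hw₀N' : w₀N = (i.liftInst R).extR g := by
    rw [hw₀N, hw₀, hu₀, cutNear_H₀L_pull i F ha hℓ hSR, hg, extR_cutNear_pull i (by omega) f]
  have hpull : pull (Nat.one_le_pow i.k (ℓ + 1) (Nat.succ_pos ℓ)) i.hP i.hboxΩ R u = (HL i F R)⁻¹ *ᵥ g + (HL i F R)⁻¹ *ᵥ (w - wN) := by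
    rw [← hwN', ← Matrix.mulVec_add, add_sub_cancel, hw]
    exact pull_eq i F ha hℓ R u
  have hpull₀ : pull (Nat.one_le_pow i.k (ℓ + 1) (Nat.succ_pos ℓ)) i.hP i.hbox R u₀
      = (H₀L i F R)⁻¹ *ᵥ (i.liftInst R).extR g + (H₀L i F R)⁻¹ *ᵥ (w₀ - w₀N) := by
    rw [← hw₀N', ← Matrix.mulVec_add, add_sub_cancel, hw₀]
    exact pull₀_eq i F ha hℓ R u₀
  -- the lattice fields
  set A : (↥(fineDom ((ℓ + 1) ^ i.k) (liftLabels i.P R i.ΩT)) × ι → ℝ) →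
      (↥(fineDom ((ℓ + 1) ^ i.k) (liftLabels i.P R i.ΩT)) × ι → ℝ) :=
    fun g' => DL i F R μ *ᵥ ((HL i F R)⁻¹ *ᵥ g') with hA
  set B : (↥(fineDom ((ℓ + 1) ^ i.k) (liftLabels i.P R i.Ω₀T)) × ι → ℝ) →
      (↥(fineDom ((ℓ + 1) ^ i.k) (liftLabels i.P R i.Ω₀T)) × ι → ℝ) :=
    fun g' => D₀L i F R μ *ᵥ ((H₀L i F R)⁻¹ *ᵥ g') with hB
  set VL := (i.liftInst R).DΩ F μ *ᵥ (i.liftInst R).deltaV F g with hVL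
  -- the torus field at the two points
  have hVat : ∀ (z : ↥(fineDom ((ℓ + 1) ^ i.k) (liftLabels i.P R i.ΩT))), IsInt ((ℓ + 1) ^ i.k) i.P R z.1 →
      twrap ((ℓ + 1) ^ i.k) i.P ((proj (Nat.one_le_pow i.k (ℓ + 1) (Nat.succ_pos ℓ)) i.hP i.hboxΩ R z).1 + e1 μ) ∈ fineDom ((ℓ + 1) ^ i.k) i.ΩT →
      fld V (proj (Nat.one_le_pow i.k (ℓ + 1) (Nat.succ_pos ℓ)) i.hP i.hboxΩ R z)
        = (fld (A g) z - fld (B ((i.liftInst R).extR g))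
            (incl (Nat.one_le_pow i.k (ℓ + 1) (Nat.succ_pos ℓ)) (i.liftInst R).hsub z))
          + (fld (A (w - wN)) z - fld (B (w₀ - w₀N))
            (incl (Nat.one_le_pow i.k (ℓ + 1) (Nat.succ_pos ℓ)) (i.liftInst R).hsub z)) := by
    intro z hz hzb
    have h1 := i.fld_DT_deltaT F μ f (proj (Nat.one_le_pow i.k (ℓ + 1) (Nat.succ_pos ℓ)) i.hP i.hboxΩ R z) hzb
    have h2 := fld_regionDeriv_pull F (Nat.one_le_pow i.k (ℓ + 1) (Nat.succ_pos ℓ)) i.hP i.h3 i.hboxΩ R i.e i.Ac μ u z hz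
    have h3 := fld_regionDeriv_pull F (Nat.one_le_pow i.k (ℓ + 1) (Nat.succ_pos ℓ)) i.hP i.h3 i.hbox R i.e i.Ac μ u₀
      (incl (Nat.one_le_pow i.k (ℓ + 1) (Nat.succ_pos ℓ)) (i.liftInst R).hsub z) hz
    rw [proj_incl] at h3
    rw [hV, h1, ← hu, ← hu₀, ← h2, ← h3, hpull, hpull₀, Matrix.mulVec_add, Matrix.mulVec_add]
    show fld (A g) z + fld (A (w - wN)) z - (fld (B ((i.liftInst R).extR g)) _ + fld (B (w₀ - w₀N)) _) = _
    abel
  have hVx : fld V x = (fld (A g) xL - fld (B ((i.liftInst R).extR g)) yL)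
      + (fld (A (w - wN)) xL - fld (B (w₀ - w₀N)) yL) := by
    have h := hVat xL hint0 (by rw [hproj]; exact hbx); rwa [hproj] at h
  have hVx' : fld V x' = (fld (A g) xL' - fld (B ((i.liftInst R).extR g)) yL')
      + (fld (A (w - wN)) xL' - fld (B (w₀ - w₀N)) yL') := by
    have h := hVat xL' hint' (by rw [hproj']; exact hbx'); rwa [hproj'] at h
  -- the lattice field at the two points
  have hVLat : ∀ (z : ↥(fineDom ((ℓ + 1) ^ i.k) (liftLabels i.P R i.ΩT))),
      z.1 + e1 μ ∈ fineDom ((ℓ + 1) ^ i.k) (liftLabels i.P R i.ΩT) →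
      fld VL z = fld (A g) z - fld (B ((i.liftInst R).extR g))
        (incl (Nat.one_le_pow i.k (ℓ + 1) (Nat.succ_pos ℓ)) (i.liftInst R).hsub z) := by
    intro z hz
    funext jj
    exact (i.liftInst R).fld_DΩ_deltaV_apply F μ g z hz jj
  have hVLx : fld VL xL = fld (A g) xL - fld (B ((i.liftInst R).extR g)) yL := hVLat xL hbL
  have hVLx' : fld VL xL' = fld (A g) xL' - fld (B ((i.liftInst R).extR g)) yL' := hVLat xL' hbL'
  set U := transport (fieldLink F i.κ fun a b : ↥(fineDom ((ℓ + 1) ^ i.k) (liftLabels i.P R i.ΩT)) =>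
    compField (perField ((ℓ + 1) ^ i.k) i.P i.Ac) a.1 b.1) xL lL with hU
  have hsplit : transport (fieldLink F i.κ fun a b : ↥(fineDom ((ℓ + 1) ^ i.k) i.ΩT) =>
        torBond ((ℓ + 1) ^ i.k) i.P i.Ac a.1 b.1) x l *ᵥ fld V x' - fld V x
      = (U *ᵥ fld VL xL' - fld VL xL)
        + (U *ᵥ (fld (A (w - wN)) xL' - fld (B (w₀ - w₀N)) yL') - (fld (A (w - wN)) xL - fld (B (w₀ - w₀N)) yL)) := by
    rw [← htrans, hVx, hVx', hVLx, hVLx', Matrix.mulVec_add]; abel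
  -- the weights agree
  have hWL : (i.liftInst R).wt α xL xL' = W := by
    show ((((ℓ + 1) ^ i.k : ℕ) : ℝ) / supNorm (xL'.1 - xL.1)) ^ α = W
    rw [hdist]
    rfl
  -- the near piece via the lattice (1.11)
  have hmain : W * siteNorm (U *ᵥ fld VL xL' - fld VL xL)
      ≤ c₀ * Real.exp (-(δ₀ * m)) * Real.exp (-(δ₀ * mb + δ₀ * E)) * supN f := by
    by_cases hne : ((i.liftInst R).supp g).Nonempty
    · have h1 := le_holderQ (i.liftInst R) F (α := α) VL hAdm
      rw [hWL] at h1
      have h2 := h1.trans ((HI R).2.1 μ g xL xL' (Or.inr hcd2))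
      refine h2.trans (decay_mono₂ hc.le hδ.le (le_min ?_ ?_) hmb ?_ ?_ (supN_nonneg _))
      · refine (min_le_left _ _).trans (lat_le_sdist1 (i.liftInst R) xL g hne fun z hz => ?_)
        have := tsdist1_le_of_supp_cutNear i R S f xL z hz
        rwa [hproj] at this
      · refine (min_le_right _ _).trans (lat_le_sdist1 (i.liftInst R) xL' g hne fun z hz => ?_)
        have := tsdist1_le_of_supp_cutNear i R S f xL' z hz
        rwa [hproj'] at this
      · refine lat_le_bdistS (i.liftInst R) g hne fun z hz => ?_
        obtain ⟨hzN, hzs⟩ := supp_cutNear_pull i R S f z hz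
        refine le_cdist_lift i R z hzN (Or.inr (tbdistS_le i.P f hzs)) ?_
        rw [hRS]; linarith
      · rw [hg]; exact (supN_cutNear_le _).trans (supN_pull_le (Nat.one_le_pow i.k (ℓ + 1) (Nat.succ_pos ℓ)) i.hP i.hboxΩ R f)
    · have h0 : g = 0 := funext fun p => congrFun (lat_eq_zero_of_supp (i.liftInst R) hne) p
      have h0' : (i.liftInst R).extR g = (0 : ↥(fineDom ((ℓ + 1) ^ i.k) (liftLabels i.P R i.Ω₀T)) × ι → ℝ) := by
        rw [h0]; exact lat_extR_zero _
      have hz1 : fld VL xL' = 0 := by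
        rw [hVLx', h0', h0]; simp only [hA, hB, Matrix.mulVec_zero, fld_zero, sub_self]
      have hz2 : fld VL xL = 0 := by
        rw [hVLx, h0', h0]; simp only [hA, hB, Matrix.mulVec_zero, fld_zero, sub_self]
      rw [hz1, hz2, Matrix.mulVec_zero, sub_self, siteNorm_zero, mul_zero]; exact hb0
  -- the far pieces
  have hBu : supN (w - wN) ≤ CH i * supN u :=
    calc supN (w - wN) ≤ supN w := supN_sub_cutNear_le _
      _ ≤ CH i * supN (pull (Nat.one_le_pow i.k (ℓ + 1) (Nat.succ_pos ℓ)) i.hP i.hboxΩ R u) := supN_HL_le i F ha hℓ R _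
      _ ≤ CH i * supN u := mul_le_mul_of_nonneg_left (supN_pull_le _ _ _ R u) (CH_nonneg i ha hℓ)
  have hBu₀ : supN (w₀ - w₀N) ≤ CH i * supN u₀ :=
    calc supN (w₀ - w₀N) ≤ supN w₀ := supN_sub_cutNear_le _
      _ ≤ CH i * supN (pull (Nat.one_le_pow i.k (ℓ + 1) (Nat.succ_pos ℓ)) i.hP i.hbox R u₀) := supN_H₀L_le i F ha hℓ R _
      _ ≤ CH i * supN u₀ := mul_le_mul_of_nonneg_left (supN_pull_le _ _ _ R u₀) (CH_nonneg i ha hℓ)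
  have htailA : ∀ z : ↥(fineDom ((ℓ + 1) ^ i.k) (liftLabels i.P R i.ΩT)), Near ((ℓ + 1) ^ i.k) i.P 1 z.1 →
      R₀ ≤ (i.liftInst R).cdist z →
      siteNorm (fld (A (w - wN)) z) ≤ c₀ * Real.exp (-(δ₀ * ((S : ℝ) - 1))) * (CH i * supN u) := by
    intro z hz hzc
    refine lat_decay_transfer (i.liftInst R) z (w - wN) hc.le hδ.le hBu (lat_valDG i F R (HI R).1 μ (w - wN) z hzc)
      ?_ ?_
    · intro h
      have h0 : w - wN = 0 := funext h
      simp only [hA]; rw [h0, Matrix.mulVec_zero, Matrix.mulVec_zero]; rfl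
    · intro z' hz'
      have := far_le_of_supp_sub_cutNear i (i.liftInst R) S 1 w z z' hz hz'
      simpa using this
  have htailB : ∀ z : ↥(fineDom ((ℓ + 1) ^ i.k) (liftLabels i.P R i.Ω₀T)), Near ((ℓ + 1) ^ i.k) i.P 1 z.1 →
      R₀ ≤ (i.liftInst₀ R).cdist z →
      siteNorm (fld (B (w₀ - w₀N)) z) ≤ c₀ * Real.exp (-(δ₀ * ((S : ℝ) - 1))) * (CH i * supN u₀) := by
    intro z hz hzc
    refine lat_decay_transfer (i.liftInst₀ R) z (w₀ - w₀N) hc.le hδ.le hBu₀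
      (lat_valDG₀ i F R (HI₀ R) μ (w₀ - w₀N) z hzc) ?_ ?_
    · intro h
      have h0 : w₀ - w₀N = 0 := funext h
      simp only [hB]; rw [h0, Matrix.mulVec_zero, Matrix.mulVec_zero]; rfl
    · intro z' hz'
      have := far_le_of_supp_sub_cutNear i (i.liftInst₀ R) S 1 w₀ z z' hz hz'
      simpa using this
  have hexp : Real.exp (-(δ₀ * ((S : ℝ) - 1))) = Real.exp δ₀ * Real.exp (-(δ₀ * S)) := by
    rw [← Real.exp_add]; congr 1; ring
  have ht := htailA xL (hnear0.mono (by norm_num)) hcd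
  have ht' := htailA xL' hnear1' hcd'
  have hs := htailB yL hnear0y hcd₀
  have hs' := htailB yL' hnear1y hcd₀'
  rw [hexp] at ht ht' hs hs'
  have htail : W * siteNorm (U *ᵥ (fld (A (w - wN)) xL' - fld (B (w₀ - w₀N)) yL')
        - (fld (A (w - wN)) xL - fld (B (w₀ - w₀N)) yL))
      ≤ W * (2 * (c₀ * Real.exp δ₀ * (CH i * supN u + CH i * supN u₀))) * Real.exp (-(δ₀ * S)) := by
    have h1 := siteNorm_transport_sub_le F i.κ (fun a b : ↥(fineDom ((ℓ + 1) ^ i.k) (liftLabels i.P R i.ΩT)) =>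
      compField (perField ((ℓ + 1) ^ i.k) i.P i.Ac) a.1 b.1) xL lL (fld (A (w - wN)) xL' - fld (B (w₀ - w₀N)) yL')
      (fld (A (w - wN)) xL - fld (B (w₀ - w₀N)) yL)
    have h2 := siteNorm_sub_le (fld (A (w - wN)) xL') (fld (B (w₀ - w₀N)) yL')
    have h3 := siteNorm_sub_le (fld (A (w - wN)) xL) (fld (B (w₀ - w₀N)) yL)
    calc W * siteNorm (U *ᵥ (fld (A (w - wN)) xL' - fld (B (w₀ - w₀N)) yL')
          - (fld (A (w - wN)) xL - fld (B (w₀ - w₀N)) yL))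
        ≤ W * ((siteNorm (fld (A (w - wN)) xL') + siteNorm (fld (B (w₀ - w₀N)) yL'))
            + (siteNorm (fld (A (w - wN)) xL) + siteNorm (fld (B (w₀ - w₀N)) yL))) :=
          mul_le_mul_of_nonneg_left (h1.trans (add_le_add h2 h3)) hW0
      _ ≤ W * ((c₀ * (Real.exp δ₀ * Real.exp (-(δ₀ * S))) * (CH i * supN u)
              + c₀ * (Real.exp δ₀ * Real.exp (-(δ₀ * S))) * (CH i * supN u₀))
            + (c₀ * (Real.exp δ₀ * Real.exp (-(δ₀ * S))) * (CH i * supN u)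
              + c₀ * (Real.exp δ₀ * Real.exp (-(δ₀ * S))) * (CH i * supN u₀))) :=
          mul_le_mul_of_nonneg_left (add_le_add (add_le_add ht' hs') (add_le_add ht hs)) hW0
      _ = W * (2 * (c₀ * Real.exp δ₀ * (CH i * supN u + CH i * supN u₀))) * Real.exp (-(δ₀ * S)) := by ring
  rw [hsplit]
  calc W * siteNorm (_ + _) ≤ W * (siteNorm _ + siteNorm _) := mul_le_mul_of_nonneg_left (siteNorm_add_le _ _) hW0
    _ = W * siteNorm _ + W * siteNorm _ := mul_add _ _ _
    _ ≤ _ := add_le_add hmain htail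

end Members

/-! ## §4. The Theorem, (1.8) and non-vacuity on the torus family -/

section Assembly

open LiftData

/-- **THEOREM p. 573, (1.9)–(1.12), ON THE FAMILY OF TORUS REGION PAIRS `Ω ⊂ Ω₀ ⊂ T_η` AT A (1.7)-REGULAR TORUS
FIELD, IN THE TYPED `η`-UNIFORM FORM `ThmPrintedNN`.**  For the family `torusPairFam` (block size `K = Kmod`, the
lattice family's): for every `0 ≤ α < 1` there are `δ₀, c₀, R₀, e₁ > 0` such that for every instance whose torus field is
(1.7)-regular on `Ω₀`, whose `Ω`, `Ω₀`, `T_η` are unions of `K`-blocks, and whose coupling is `0 < e ≤ e₁`, the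
inequalities (1.9)–(1.10) hold for `G_k(Ω,A)` and (1.9)–(1.10) with the factor (1.12) hold for `δG_k(Ω,Ω₀,A)` at all
`x, x′ ∈ Ω` with `dist_T({x,x′}, Ω^c) ≥ R₀` (resp. `dist_T(x, Ω^c) ≥ R₀`), and for `Ω = T_η` without restriction —
`Ineq19_110 ∧ Ineq111_112`; the constants are the lattice family's `δ₀, R₀, e₁` and `4(d+1)c₀`.  «Another common case is
to consider operators on subsets of a torus T_η … with periodic conditions.» [cite: Balaban1983RegularityDecay, Theorem (1.9)–(1.12) p.573, p.572 «operators on subsets of a torus T_η»] -/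
theorem thmPrintedNN_torusPairFam (F : OrthFlow ι) {ℓ₁ : ℝ} (hℓ₁ : 0 ≤ ℓ₁)
    (hLip : ∀ t (v : ι → ℝ), ((F.U t - 1) *ᵥ v) ⬝ᵥ ((F.U t - 1) *ᵥ v) ≤ (ℓ₁ * t) ^ 2 * (v ⬝ᵥ v))
    (d ℓ : ℕ) (hℓ : 1 ≤ ℓ) (amin aplus m2plus : ℝ) (ha : 0 < amin) (creg β : ℝ) (hcreg : 0 ≤ creg)
    (hβ : 0 < β) :
    ThmPrintedNN (torusPairFam F d ℓ amin aplus m2plus creg β (Kmod F hℓ₁ hLip d ℓ hℓ amin aplus m2plus ha)) := by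
  intro α hα0 hα1
  obtain ⟨δ₀, c₀, R₀, e₁, hδ, hc, hR₀, he₁, H⟩ :=
    thmPrintedNN_regionPairFam F hℓ₁ hLip d ℓ hℓ amin aplus m2plus ha creg β hcreg hβ α hα0 hα1
  have hK16 : 16 ≤ Kmod F hℓ₁ hLip d ℓ hℓ amin aplus m2plus ha :=
    (Classical.choose_spec (region_pair_members F hℓ₁ hLip d ℓ hℓ amin aplus m2plus ha)).1
  have hK1 : 1 ≤ Kmod F hℓ₁ hLip d ℓ hℓ amin aplus m2plus ha := le_trans (by norm_num) hK16
  have hd : (0 : ℝ) ≤ d := Nat.cast_nonneg d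
  refine ⟨δ₀, 4 * ((d : ℝ) + 1) * c₀, R₀, e₁, hδ, by positivity, hR₀, he₁, ?_⟩
  intro i hreg hbig he hle
  have HI : ∀ R : ℕ,
      Ineq19_110 (regionPairFam F d ℓ amin aplus m2plus creg β (Kmod F hℓ₁ hLip d ℓ hℓ amin aplus m2plus ha)
        (i.liftInst R)) α δ₀ c₀ R₀ ∧
      Ineq111_112 (regionPairFam F d ℓ amin aplus m2plus creg β (Kmod F hℓ₁ hLip d ℓ hℓ amin aplus m2plus ha)
        (i.liftInst R)) α δ₀ c₀ R₀ :=
    fun R => H (i.liftInst R) (i.regular_lift F R hreg) (i.bigBlocks_lift F hK1 R hbig) he hle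
  have HI' : ∀ R : ℕ,
      Ineq19_110 (regionPairFam F d ℓ amin aplus m2plus creg β (Kmod F hℓ₁ hLip d ℓ hℓ amin aplus m2plus ha)
        (i.liftInst R)) α δ₀ c₀ R₀ := fun R => (HI R).1
  have HI₀ : ∀ R : ℕ,
      Ineq19_110 (regionPairFam F d ℓ amin aplus m2plus creg β (Kmod F hℓ₁ hLip d ℓ hℓ amin aplus m2plus ha)
        (i.liftInst₀ R)) α δ₀ c₀ R₀ :=
    fun R => (H (i.liftInst₀ R) (i.regular_lift₀ F R hreg) (i.bigBlocks_lift₀ F hK1 R hbig) he hle).1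
  have he' : 0 < i.e := he
  have hc4 : c₀ ≤ 4 * ((d : ℝ) + 1) * c₀ := by nlinarith
  have hw1 : ∀ {E s : ℝ}, 0 ≤ E → 0 ≤ s → c₀ * E * s ≤ 4 * ((d : ℝ) + 1) * c₀ * E * s :=
    fun hE hs => mul_le_mul_of_nonneg_right (mul_le_mul_of_nonneg_right hc4 hE) hs
  have hw2 : ∀ {E E' s : ℝ}, 0 ≤ E → 0 ≤ E' → 0 ≤ s → c₀ * E * E' * s ≤ 4 * ((d : ℝ) + 1) * c₀ * E * E' * s :=
    fun hE hE' hs => mul_le_mul_of_nonneg_right (mul_le_mul_of_nonneg_right (mul_le_mul_of_nonneg_right hc4 hE) hE') hs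
  refine ⟨⟨fun μ f x x' hxx => ?_, fun μ f x hx1 => ⟨?_, ?_⟩⟩, ⟨fun μ f x x' hxx => ?_, fun μ f x hx1 => ⟨?_, ?_⟩⟩⟩
  · exact lhs19_torus i F ha hℓ hδ hc hα0 hα1.le HI' μ f x x' hxx
  · exact (valDG_torus i F ha hℓ hδ hc HI' μ f x hx1).trans (hw1 (Real.exp_pos _).le (supN_nonneg _))
  · exact (valG_torus i F ha hℓ hδ hc HI' f x hx1).trans (hw1 (Real.exp_pos _).le (supN_nonneg _))
  · exact dlhs19_torus i F ha hℓ hδ hc hα0 hα1.le HI HI₀ μ f x x' hxx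
  · exact (dvalDG_torus i F ha hℓ hδ hc HI HI₀ μ f x hx1).trans
      (hw2 (Real.exp_pos _).le (Real.exp_pos _).le (supN_nonneg _))
  · exact (dvalG_torus i F ha hℓ hδ hc HI HI₀ f x hx1).trans
      (hw2 (Real.exp_pos _).le (Real.exp_pos _).le (supN_nonneg _))

/-- **(1.8) ON THE FAMILY OF TORUS REGION PAIRS AT A (1.7)-REGULAR TORUS FIELD, IN THE TYPED `η`-UNIFORM FORM
`B4.Claim18Printed`**: «there exists a positive constant γ₀ such that for e sufficiently small and for a regular vector
field A −Δ^{η,N}_{A,Ω} + aP_k(A) ≥ γ₀I … independent of the lattice spacing η, as well as of Ω and of A» — for every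
torus region `Ω ⊂ T_η`, with `γ₀ = min(2, 3a₋/4)/4` (the representatives form a lattice region whose form the torus form
dominates). [cite: Balaban1983RegularityDecay, (1.8) p.573, p.572 «operators on subsets of a torus T_η»] -/
theorem claim18Printed_torusPairFam (F : OrthFlow ι) {ℓ₁ : ℝ} (hℓ₁ : 0 ≤ ℓ₁)
    (hLip : ∀ t (v : ι → ℝ), ((F.U t - 1) *ᵥ v) ⬝ᵥ ((F.U t - 1) *ᵥ v) ≤ (ℓ₁ * t) ^ 2 * (v ⬝ᵥ v))
    (d ℓ : ℕ) (hℓ : 1 ≤ ℓ) (amin aplus m2plus : ℝ) (ha : 0 < amin) (creg β : ℝ) (hcreg : 0 ≤ creg)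
    (hβ : 0 < β) (K : ℕ) :
    Claim18Printed (torusPairFam F d ℓ amin aplus m2plus creg β K) := by
  obtain ⟨γ₀, e₁, hγ, he₁, H⟩ := claim18Printed_regionPairFam F hℓ₁ hLip d ℓ hℓ amin aplus m2plus ha creg β hcreg hβ K
  refine ⟨γ₀, e₁, hγ, he₁, fun i hreg he hle => ?_⟩
  intro v
  have h := H i.oneInst (i.regular_one F hreg) he hle v
  exact h.trans (regionOp_form_le_torusOp_form F (Nat.one_le_pow i.k (ℓ + 1) (Nat.succ_pos ℓ)) i.h3 i.hboxΩ i.e i.aK i.m2 i.Ac v)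

/-- **NON-VACUITY**: for every block size `K ≥ 1` and threshold `e₁ > 0` there are torus instances satisfying
`regular`, `bigBlocks` and `0 < e ≤ e₁` (e.g. `A = 0`, `Ω = Ω₀ =` one `K`-cube of unit labels on the torus of `3K` unit
blocks per direction at scale `k = 1`). [cite: Balaban1983RegularityDecay, Theorem p.573, dictionary] -/
theorem hypotheses_met (F : OrthFlow ι) (d ℓ : ℕ) {amin aplus m2plus : ℝ} (hap : amin ≤ aplus) (hm : 0 ≤ m2plus)
    (creg β : ℝ) (hcreg : 0 ≤ creg) (K : ℕ) (hK : 1 ≤ K) (e₁ : ℝ) (he₁ : 0 < e₁) :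
    ∃ i : TorusPairInst d ℓ amin aplus m2plus,
      (torusPairFam F d ℓ amin aplus m2plus creg β K i).regular ∧
      (torusPairFam F d ℓ amin aplus m2plus creg β K i).bigBlocks ∧
      0 < (torusPairFam F d ℓ amin aplus m2plus creg β K i).e ∧
      (torusPairFam F d ℓ amin aplus m2plus creg β K i).e ≤ e₁ := by
  have hbox : fineDom K ({0} : Finset (Fin (d + 1) → ℤ)) ⊆ boxDom (fun _ : Fin (d + 1) => 3 * K) := by
    intro y hy
    have hy0 : blk K y = 0 := Finset.mem_singleton.1 ((mem_fineDom hK).1 hy)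
    rw [mem_boxDom]
    intro ν
    have hK0 : (0 : ℤ) < K := by exact_mod_cast hK
    have h1 : y ν / (K : ℤ) = 0 := congrFun hy0 ν
    have h2 := Int.mul_ediv_add_emod (y ν) (K : ℤ)
    rw [h1, mul_zero, zero_add] at h2
    have h3 := Int.emod_nonneg (y ν) hK0.ne'
    have h4 := Int.emod_lt_of_pos (y ν) hK0
    constructor
    · linarith
    · push_cast; linarith
  have h3 : ∀ ν : Fin (d + 1), 3 ≤ per ((ℓ + 1) ^ 1) (fun _ : Fin (d + 1) => 3 * K) ν := by
    intro ν
    show 3 ≤ (ℓ + 1) ^ 1 * (3 * K)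
    nlinarith [Nat.one_le_pow 1 (ℓ + 1) (Nat.succ_pos ℓ)]
  let i0 : TorusPairInst d ℓ amin aplus m2plus :=
    { k := 1
      hk := le_rfl
      P := fun _ => 3 * K
      hP := fun _ => by omega
      h3 := h3
      Ω₀T := fineDom K {0}
      ΩT := fineDom K {0}
      hbox := hbox
      hsub := Finset.Subset.refl _
      a := amin
      m2 := 0
      ha1 := le_rfl
      ha2 := hap
      hm1 := le_rfl
      hm2 := hm
      Ac := fun _ _ => 0
      e := e₁ }
  refine ⟨i0, ?_, ⟨fineDom_isBlockUnion hK _, fineDom_isBlockUnion hK _, fun _ => Dvd.intro_left 3 rfl⟩, he₁, le_rfl⟩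
  intro x _ μ ν
  change |(0 : ℝ) - 0| ≤ creg * e₁ ^ (β - 1) / ((ℓ + 1) ^ 1 : ℕ)
  rw [sub_self, abs_zero]
  positivity

end Assembly

end

end Literature.MathematicalPhysics.QuantumFieldTheory.Balaban1983to89.B4ThmTorusPairEta
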